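import Literature.Analysis.Complex.HormanderL2Existence
import Literature.Analysis.Complex.RiemannDomainWeyl
import HarnessLib

/-!
# `L²` interpolation on a flat Riemann domain (Hörmander §4.4)

Layer `Literature/Analysis/Complex`; the transplant of the interpolation argument of L. Hörmander,
*An Introduction to Complex Analysis in Several Variables* (1973), Theorems 4.4.3–4.4.4 (holomorphic
functions with prescribed values and `L²` bounds from the existence theorem for `∂̄` with the
singular weight `2n log |z - z₀|`) to a flat Riemann domain `D` over `ℂ^ι` carrying a strictly
plurisubharmonic `C^∞` exhaustion `s` and a strictly plurisubharmonic `C^∞` weight `φ₀`.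

**Theorem** (`exists_flatHolomorphic_interpolating`). Let `t₁, …, t_N ∈ D` be distinct points of
one fibre `proj tᵢ = z₀` and `c₁, …, c_N ∈ ℂ`. Then there is a continuous `h : D → ℂ`, holomorphic
along every local inverse of `proj`, with `h(tᵢ) = cᵢ` and
`∫ |h|² e^{-φ₀} (1 + |proj - z₀|²)^{-n} d vol < ∞` (`n = card ι`).

Proof (pp. 93–94, regularised): with `u₀ = ∑ cᵢ χᵢ` (cut-offs on disjoint sheets over a polydisc
about `z₀`) solve `∂̄ v_ε = ∂̄ u₀` by `hormander_existence` for the smooth plurisubharmonic weights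
`φ_ε = φ₀ + n log(|proj - z₀|² + ε²)` (`pointWeight`, Levi form `≥ 0`:
`re_levi_pointWeight_nonneg`), with bounds uniform in `ε`; a weak limit `v` (`exists_weak_limit`)
solves `∂̄ v = ∂̄ u₀` with `∫ |v|² e^{-φ₀} |proj - z₀|^{-2n} < ∞`; by Weyl's lemma `v` is
holomorphic near the fibre, and the non-integrability of `|z - z₀|^{-2n}` in `ℂ^n`
(`not_integrableOn_norm_rpow_neg`) forces `v = 0` on it; `h = u₀ - v`.

Everything is proved; no named facts.

## References

* L. Hörmander, *An Introduction to Complex Analysis in Several Variables* (1973), §4.4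
  (Thm 4.4.3, Thm 4.4.4, pp. 93–94), Lemma 4.4.1. [HormanderSCV1973]

#harness_tags complex_analysis.several_variables, complex_analysis.l2_estimates, complex_geometry.riemann_existence
-/

noncomputable section

open scoped Manifold ContDiff Topology ComplexConjugate NNReal InnerProductSpace ENNReal
open Set Filter Function Complex MeasureTheory MeasureTheory.Measure Metric

namespace Literature.Analysis.Complex

/-! ### Non-integrability of `|z - z₀|^{-2n}` in `ℂ^n` -/

namespace PointWeightSCV

variable {ι : Type} [Fintype ι]

/-- The squared Euclidean norm on `ℂ^ι`: `E(z) = ∑_j |z_j|²`. [folklore] -/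
def euclidSq (z : ι → ℂ) : ℝ := ∑ j, ‖z j‖ ^ 2

/-- `E ≥ 0`. [folklore] -/
theorem euclidSq_nonneg (z : ι → ℂ) : 0 ≤ euclidSq z := Finset.sum_nonneg fun _ _ ↦ sq_nonneg _

/-- `E(r z) = r² E(z)`. [folklore] -/
theorem euclidSq_smul (r : ℝ) (z : ι → ℂ) : euclidSq (r • z) = r ^ 2 * euclidSq z := by
  simp only [euclidSq, Pi.smul_apply, norm_smul, Real.norm_eq_abs, mul_pow, sq_abs, Finset.mul_sum]

/-- The sup norm is dominated by the Euclidean norm: `‖z‖² ≤ E(z)`. [folklore] -/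
theorem norm_sq_le_euclidSq (z : ι → ℂ) : ‖z‖ ^ 2 ≤ euclidSq z := by
  rcases isEmpty_or_nonempty ι with hι | hι
  · simp [Subsingleton.elim z 0, euclidSq]
  · obtain ⟨j, -, hj⟩ := Finset.exists_max_image Finset.univ (fun j ↦ ‖z j‖) Finset.univ_nonempty
    have hnorm : ‖z‖ = ‖z j‖ := le_antisymm ((pi_norm_le_iff_of_nonneg (norm_nonneg _)).2 fun k ↦ hj k (Finset.mem_univ _))
      (norm_le_pi_norm z j)
    rw [hnorm]
    exact Finset.single_le_sum (f := fun k ↦ ‖z k‖ ^ 2) (fun k _ ↦ sq_nonneg _) (Finset.mem_univ j)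

/-- `E(z) > 0` for `z ≠ 0`. [folklore] -/
theorem euclidSq_pos {z : ι → ℂ} (hz : z ≠ 0) : 0 < euclidSq z :=
  lt_of_lt_of_le (by positivity) (norm_sq_le_euclidSq z)

/-- `E` is continuous. [folklore] -/
theorem continuous_euclidSq : Continuous (euclidSq : (ι → ℂ) → ℝ) :=
  continuous_finsetSum _ fun j _ ↦ ((continuous_apply j).norm).pow 2

/-- The singular weight `(E^n)⁻¹`, `n = card ι`, as an `ℝ≥0∞`-valued function. [folklore] -/
def singWeight (z : ι → ℂ) : ℝ≥0∞ := ENNReal.ofReal ((euclidSq z ^ Fintype.card ι)⁻¹)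

/-- The singular weight is measurable. [folklore] -/
theorem measurable_singWeight : Measurable (singWeight : (ι → ℂ) → ℝ≥0∞) :=
  ENNReal.measurable_ofReal.comp ((continuous_euclidSq.pow _).measurable.inv)

/-- Scaling: `(E(2z)^n)⁻¹ = (4^n)⁻¹ (E(z)^n)⁻¹`. [folklore] -/
theorem singWeight_two_smul (z : ι → ℂ) : singWeight ((2 : ℝ) • z) = ENNReal.ofReal ((4 ^ Fintype.card ι : ℝ)⁻¹) * singWeight z := by
  rw [singWeight, singWeight, euclidSq_smul, mul_pow, mul_inv, ← ENNReal.ofReal_mul (by positivity)]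
  norm_num

/-- **`|z|^{-2n}` is not integrable at the origin of `ℂ^n`** (`n = card ι ≥ 1`): the integral of
`(E^n)⁻¹` over every polydisc about `0` is infinite (scaling `z ↦ 2z` preserves the integral, so the
annuli would carry no mass — absurd). [cite: HormanderSCV1973, Thm 4.4.3 (proof: «`|z|^{-2n}` is not integrable at `0`»)] -/
theorem lintegral_ball_singWeight_eq_top [Nonempty ι] {r : ℝ} (hr : 0 < r) :
    ∫⁻ z in ball (0 : ι → ℂ) r, singWeight z = ⊤ := by
  set n : ℕ := Fintype.card ι with hn
  set I : ℝ → ℝ≥0∞ := fun ρ ↦ ∫⁻ z in ball (0 : ι → ℂ) ρ, singWeight z with hI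
  -- scaling: `I(ρ/2) = I(ρ)`
  have hscale : ∀ ρ : ℝ, I (ρ / 2) = I ρ := by
    intro ρ
    have hmap := map_addHaar_smul (volume : Measure (ι → ℂ)) (two_ne_zero (α := ℝ))
    have hmeas : Measurable fun z : ι → ℂ ↦ (ball (0 : ι → ℂ) ρ).indicator singWeight z :=
      measurable_singWeight.indicator measurableSet_ball
    have h1 : ∫⁻ z, (ball (0 : ι → ℂ) ρ).indicator singWeight ((2 : ℝ) • z) =
        ENNReal.ofReal (|((2 : ℝ) ^ Module.finrank ℝ (ι → ℂ))⁻¹|) * ∫⁻ z, (ball (0 : ι → ℂ) ρ).indicator singWeight z := by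
      rw [← lintegral_map hmeas (measurable_const_smul (2 : ℝ)), hmap, lintegral_smul_measure, smul_eq_mul]
    have h2 : ∀ z : ι → ℂ, (ball (0 : ι → ℂ) ρ).indicator singWeight ((2 : ℝ) • z) =
        ENNReal.ofReal ((4 ^ n : ℝ)⁻¹) * (ball (0 : ι → ℂ) (ρ / 2)).indicator singWeight z := by
      intro z
      have hmem : (2 : ℝ) • z ∈ ball (0 : ι → ℂ) ρ ↔ z ∈ ball (0 : ι → ℂ) (ρ / 2) := by
        rw [mem_ball_zero_iff, mem_ball_zero_iff, norm_smul, Real.norm_eq_abs, abs_of_pos two_pos]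
        constructor <;> intro h <;> linarith
      by_cases hz : z ∈ ball (0 : ι → ℂ) (ρ / 2)
      · rw [indicator_of_mem (hmem.2 hz), indicator_of_mem hz, singWeight_two_smul]
      · rw [indicator_of_notMem (fun h ↦ hz (hmem.1 h)), indicator_of_notMem hz, mul_zero]
    simp_rw [h2] at h1
    have hfr : Module.finrank ℝ (ι → ℂ) = 2 * Fintype.card ι := by
      rw [Module.finrank_pi_fintype]; simp [Complex.finrank_real_complex, mul_comm]
    rw [lintegral_const_mul _ (measurable_singWeight.indicator measurableSet_ball), hfr, pow_mul,
      show ((2 : ℝ) ^ 2) = 4 by norm_num, abs_of_pos (by positivity), MeasureTheory.lintegral_indicator measurableSet_ball,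
      MeasureTheory.lintegral_indicator measurableSet_ball] at h1
    exact (ENNReal.mul_right_inj (by positivity) ENNReal.ofReal_ne_top).1 h1
  -- hence `I(r) = I(r/2) + ∫_{annulus}`, and the annulus integral vanishes if `I(r) < ⊤`
  by_contra htop
  have hlt : I r < ⊤ := lt_top_iff_ne_top.2 htop
  set A : Set (ι → ℂ) := ball 0 r \ ball 0 (r / 2) with hA
  have hAm : MeasurableSet A := measurableSet_ball.diff measurableSet_ball
  have hunion : ball (0 : ι → ℂ) r = ball 0 (r / 2) ∪ A := by
    rw [hA, Set.union_sdiff_cancel (ball_subset_ball (by linarith))]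
  have hdisj : Disjoint (ball (0 : ι → ℂ) (r / 2)) A := disjoint_sdiff_right
  have hsplit : I r = I (r / 2) + ∫⁻ z in A, singWeight z := by
    simp only [hI]
    rw [hunion, lintegral_union hAm hdisj]
  rw [hscale r] at hsplit
  have hA0 : ∫⁻ z in A, singWeight z = 0 :=
    (ENNReal.add_right_inj hlt.ne).1 ((add_zero _).trans hsplit).symm
  -- but the weight is positive on the annulus, which has positive measure
  have hpos : ∀ z ∈ A, singWeight z ≠ 0 := fun z hz ↦ by
    have hz0 : z ≠ 0 := fun h ↦ by
      rw [h] at hz; exact hz.2 (mem_ball_self (by positivity))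
    rw [singWeight, ne_eq, ENNReal.ofReal_eq_zero, not_le]
    exact inv_pos.2 (pow_pos (euclidSq_pos hz0) _)
  have hae : ∀ᵐ z ∂(volume.restrict A), singWeight z = 0 :=
    (lintegral_eq_zero_iff measurable_singWeight).1 hA0
  rw [ae_restrict_iff' hAm] at hae
  have hAnull : volume A = 0 :=
    measure_eq_zero_iff_ae_notMem.2 (hae.mono fun z hz hzA ↦ hpos z hzA (hz hzA))
  -- a small ball inside the annulus
  set x₀ : ι → ℂ := fun _ ↦ ((3 * r / 4 : ℝ) : ℂ) with hx₀
  have hx₀norm : ‖x₀‖ = 3 * r / 4 := by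
    rw [hx₀, pi_norm_const, norm_real, Real.norm_of_nonneg (by positivity)]
  have hsub : ball x₀ (r / 8) ⊆ A := fun y hy ↦ by
    rw [mem_ball, dist_eq_norm] at hy
    have h1 : ‖y‖ ≤ ‖y - x₀‖ + ‖x₀‖ := norm_le_norm_sub_add y x₀
    have h2 : ‖x₀‖ ≤ ‖x₀ - y‖ + ‖y‖ := norm_le_norm_sub_add x₀ y
    rw [norm_sub_rev] at h2
    refine ⟨mem_ball_zero_iff.2 (by linarith), fun h ↦ ?_⟩
    rw [mem_ball_zero_iff] at h
    linarith
  have hball : 0 < volume (ball x₀ (r / 8)) := measure_ball_pos volume x₀ (by positivity)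
  exact absurd (measure_mono_null hsub hAnull) hball.ne'

/-- **Vanishing forced by the singular weight**: if `H` is continuous at `z₀` and
`∫_{B(z₀,r)} |H|² E(z - z₀)^{-n} < ∞` then `H(z₀) = 0`. [cite: HormanderSCV1973, Thm 4.4.3 (proof)] -/
theorem eq_zero_of_lintegral_lt_top [Nonempty ι] {H : (ι → ℂ) → ℂ} {z₀ : ι → ℂ} (hH : ContinuousAt H z₀) {r : ℝ} (hr : 0 < r)
    (hfin : ∫⁻ z in ball z₀ r, ENNReal.ofReal (‖H z‖ ^ 2) * singWeight (z - z₀) < ⊤) : H z₀ = 0 := by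
  by_contra h0
  have hH0 : 0 < ‖H z₀‖ := norm_pos_iff.2 h0
  -- continuity: `‖H z‖ ≥ ‖H z₀‖/2` on a small ball
  obtain ⟨δ, hδ, hδH⟩ := Metric.continuousAt_iff.1 hH (‖H z₀‖ / 2) (by positivity)
  set δ' := min δ r with hδ'
  have hδ'0 : 0 < δ' := lt_min hδ hr
  have hlow : ∀ z ∈ ball z₀ δ', ENNReal.ofReal ((‖H z₀‖ / 2) ^ 2) ≤ ENNReal.ofReal (‖H z‖ ^ 2) := fun z hz ↦ by
    refine ENNReal.ofReal_le_ofReal (pow_le_pow_left₀ (by positivity) ?_ 2)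
    have h1 := hδH (lt_of_lt_of_le (mem_ball.1 hz) (min_le_left _ _))
    rw [dist_eq_norm] at h1
    have h2 : ‖H z₀‖ ≤ ‖H z - H z₀‖ + ‖H z‖ := by
      have := norm_le_norm_sub_add (H z₀) (H z); rwa [norm_sub_rev] at this
    linarith
  -- `∫_{B(z₀,δ')} |H|² w ≥ (‖H z₀‖/2)² ∫_{B(z₀,δ')} w = ⊤`
  have hmono : ∫⁻ z in ball z₀ δ', ENNReal.ofReal ((‖H z₀‖ / 2) ^ 2) * singWeight (z - z₀) ≤
      ∫⁻ z in ball z₀ r, ENNReal.ofReal (‖H z‖ ^ 2) * singWeight (z - z₀) := by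
    calc ∫⁻ z in ball z₀ δ', ENNReal.ofReal ((‖H z₀‖ / 2) ^ 2) * singWeight (z - z₀)
        ≤ ∫⁻ z in ball z₀ δ', ENNReal.ofReal (‖H z‖ ^ 2) * singWeight (z - z₀) :=
          setLIntegral_mono' measurableSet_ball fun z hz ↦ mul_le_mul_left (hlow z hz) _
      _ ≤ _ := lintegral_mono_set (ball_subset_ball (min_le_right _ _))
  have htrans : ∫⁻ z in ball z₀ δ', singWeight (z - z₀) = ∫⁻ z in ball (0 : ι → ℂ) δ', singWeight z := by
    have h1 : ∀ z, (ball z₀ δ').indicator (fun z ↦ singWeight (z - z₀)) z = (ball (0 : ι → ℂ) δ').indicator singWeight (z - z₀) := by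
      intro z
      have hmem : z ∈ ball z₀ δ' ↔ z - z₀ ∈ ball (0 : ι → ℂ) δ' := by rw [mem_ball_zero_iff, mem_ball, dist_eq_norm]
      by_cases hz : z ∈ ball z₀ δ'
      · rw [indicator_of_mem hz, indicator_of_mem (hmem.1 hz)]
      · rw [indicator_of_notMem hz, indicator_of_notMem (fun h ↦ hz (hmem.2 h))]
    rw [← MeasureTheory.lintegral_indicator measurableSet_ball, ← MeasureTheory.lintegral_indicator measurableSet_ball]
    simp_rw [h1]
    exact lintegral_sub_right_eq_self (fun z ↦ (ball (0 : ι → ℂ) δ').indicator singWeight z) z₀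
  have htop : ∫⁻ z in ball z₀ δ', ENNReal.ofReal ((‖H z₀‖ / 2) ^ 2) * singWeight (z - z₀) = ⊤ := by
    rw [lintegral_const_mul' _ _ ENNReal.ofReal_ne_top, htrans, lintegral_ball_singWeight_eq_top hδ'0,
      ENNReal.mul_top (by rw [ne_eq, ENNReal.ofReal_eq_zero, not_le]; positivity)]
  rw [htop, top_le_iff] at hmono
  exact absurd hmono hfin.ne

end PointWeightSCV

namespace RiemannDomain

universe u

variable {ι : Type} [Fintype ι] [DecidableEq ι] {D : RiemannDomain.{u} ι}

/-! ### The point weight `log(|proj - z₀|² + ε²)` and its Levi form -/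

section PointWeight

/-- The coordinate functions `W_k = proj_k - z₀_k`. [folklore] -/
def coordFn (D : RiemannDomain.{u} ι) (z₀ : ι → ℂ) (k : ι) (y : D) : ℂ := D.proj y k - z₀ k

/-- The squared Euclidean distance to the fibre: `N(y) = ∑_k |proj_k y - z₀_k|²`. [folklore] -/
def distSq (D : RiemannDomain.{u} ι) (z₀ : ι → ℂ) (y : D) : ℝ := ∑ k, ‖D.coordFn z₀ k y‖ ^ 2

/-- **The regularised point weight** `f_ε = log(N + ε²)`. [cite: HormanderSCV1973, Thm 4.4.3 (proof, the weight `2n log|z|`)] -/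
def pointWeight (D : RiemannDomain.{u} ι) (z₀ : ι → ℂ) (ε : ℝ) (y : D) : ℝ := Real.log (D.distSq z₀ y + ε ^ 2)

variable (z₀ : ι → ℂ)

omit [DecidableEq ι] in
/-- `N ≥ 0`. [folklore] -/
theorem distSq_nonneg (y : D) : 0 ≤ D.distSq z₀ y := Finset.sum_nonneg fun _ _ ↦ sq_nonneg _

omit [DecidableEq ι] in
/-- `N + ε² > 0` for `ε ≠ 0`. [folklore] -/
theorem distSq_add_sq_pos {ε : ℝ} (hε : ε ≠ 0) (y : D) : 0 < D.distSq z₀ y + ε ^ 2 :=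
  add_pos_of_nonneg_of_pos (distSq_nonneg z₀ y) (by positivity)

omit [DecidableEq ι] in
/-- The coordinate functions are `C^∞`. [folklore] -/
theorem contMDiff_coordFn (k : ι) : ContMDiff 𝓘(ℝ, ι → ℂ) 𝓘(ℝ, ℂ) ∞ (D.coordFn z₀ k) := by
  have : D.coordFn z₀ k = (fun z : ι → ℂ ↦ z k - z₀ k) ∘ D.proj := rfl
  rw [this]
  exact contMDiff_comp_proj ((contDiff_apply ℝ ℂ k).sub contDiff_const)

omit [DecidableEq ι] in
/-- `N` is `C^∞`. [folklore] -/
theorem contMDiff_distSq : ContMDiff 𝓘(ℝ, ι → ℂ) 𝓘(ℝ, ℝ) ∞ (D.distSq z₀) :=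
  contMDiff_finsetSum fun k _ ↦ (contDiff_norm_sq ℝ (n := ∞)).comp_contMDiff (contMDiff_coordFn z₀ k)

omit [DecidableEq ι] in
/-- `f_ε` is `C^∞` for `ε ≠ 0`. [folklore] -/
theorem contMDiff_pointWeight {ε : ℝ} (hε : ε ≠ 0) : ContMDiff 𝓘(ℝ, ι → ℂ) 𝓘(ℝ, ℝ) ∞ (D.pointWeight z₀ ε) := by
  rw [contMDiff_iff]
  intro x
  have hN := (contMDiff_iff.1 (contMDiff_distSq (D := D) z₀)) x
  have : D.pointWeight z₀ ε ∘ (D.chart x).symm = fun z ↦ Real.log ((D.distSq z₀ ∘ (D.chart x).symm) z + ε ^ 2) := rfl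
  rw [this]
  exact (hN.add contDiffOn_const).log fun z _ ↦ (distSq_add_sq_pos z₀ hε _).ne'

omit [DecidableEq ι] in
/-- The coordinate functions are flat-holomorphic: `∂̄_v W_k = 0`. [folklore] -/
theorem dbar_coordFn (k : ι) (v : ι → ℂ) (y : D) : dbar v (D.coordFn z₀ k) y = 0 := by
  have : D.coordFn z₀ k = (fun z : ι → ℂ ↦ z k - z₀ k) ∘ D.proj := rfl
  rw [this, dbar_comp_proj, dbarAlong_apply]
  have hd : fderiv ℝ (fun z : ι → ℂ ↦ z k - z₀ k) (D.proj y) = (ContinuousLinearMap.proj k : (ι → ℂ) →L[ℂ] ℂ).restrictScalars ℝ := by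
    have h1 : HasFDerivAt (fun z : ι → ℂ ↦ z k - z₀ k) ((ContinuousLinearMap.proj k : (ι → ℂ) →L[ℂ] ℂ).restrictScalars ℝ) (D.proj y) :=
      (((ContinuousLinearMap.proj k : (ι → ℂ) →L[ℂ] ℂ).restrictScalars ℝ).hasFDerivAt).sub_const (z₀ k)
    exact h1.fderiv
  rw [hd]
  simp only [ContinuousLinearMap.coe_restrictScalars', ContinuousLinearMap.proj_apply, Pi.smul_apply, smul_eq_mul]
  rw [← mul_assoc, I_mul_I]; ring

omit [DecidableEq ι] in
/-- `∂_v W_k = v_k`. [folklore] -/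
theorem del_coordFn (k : ι) (v : ι → ℂ) (y : D) : del v (D.coordFn z₀ k) y = v k := by
  have : D.coordFn z₀ k = (fun z : ι → ℂ ↦ z k - z₀ k) ∘ D.proj := rfl
  rw [this, del_comp_proj, delAlong_apply]
  have hd : fderiv ℝ (fun z : ι → ℂ ↦ z k - z₀ k) (D.proj y) = (ContinuousLinearMap.proj k : (ι → ℂ) →L[ℂ] ℂ).restrictScalars ℝ := by
    have h1 : HasFDerivAt (fun z : ι → ℂ ↦ z k - z₀ k) ((ContinuousLinearMap.proj k : (ι → ℂ) →L[ℂ] ℂ).restrictScalars ℝ) (D.proj y) :=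
      (((ContinuousLinearMap.proj k : (ι → ℂ) →L[ℂ] ℂ).restrictScalars ℝ).hasFDerivAt).sub_const (z₀ k)
    exact h1.fderiv
  rw [hd]
  simp only [ContinuousLinearMap.coe_restrictScalars', ContinuousLinearMap.proj_apply, Pi.smul_apply, smul_eq_mul]
  rw [← mul_assoc, I_mul_I]; ring

omit [DecidableEq ι] in
/-- `∂̄_v conj(W_k) = conj(v_k)`. [folklore] -/
theorem dbar_conj_coordFn (k : ι) (v : ι → ℂ) (y : D) : dbar v (fun y ↦ conj (D.coordFn z₀ k y)) y = conj (v k) := by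
  rw [dbar_conj, del_coordFn]

omit [DecidableEq ι] in
/-- `∂_v conj(W_k) = 0`. [folklore] -/
theorem del_conj_coordFn (k : ι) (v : ι → ℂ) (y : D) : del v (fun y ↦ conj (D.coordFn z₀ k y)) y = 0 := by
  rw [← Weights.conj_dbar, dbar_coordFn, map_zero]

omit [DecidableEq ι] in
/-- Additivity of `∂̄_v` over finite sums of smooth functions. [folklore] -/
theorem dbar_finset_sum {α : Type*} (S : Finset α) {f : α → D → ℂ} (hf : ∀ a ∈ S, ContMDiff 𝓘(ℝ, ι → ℂ) 𝓘(ℝ, ℂ) ∞ (f a))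
    (v : ι → ℂ) (y : D) : dbar v (fun y ↦ ∑ a ∈ S, f a y) y = ∑ a ∈ S, dbar v (f a) y := by
  classical
  induction S using Finset.induction_on with
  | empty => simp [dbar_const]
  | insert a S ha ih =>
    have hS : ∀ b ∈ S, ContMDiff 𝓘(ℝ, ι → ℂ) 𝓘(ℝ, ℂ) ∞ (f b) := fun b hb ↦ hf b (Finset.mem_insert_of_mem hb)
    simp only [Finset.sum_insert ha]
    have h1 : (fun y ↦ f a y + ∑ b ∈ S, f b y) = f a + fun y ↦ ∑ b ∈ S, f b y := rfl
    rw [h1, dbar_add (differentiableAt_comp_symm_of_contMDiff (hf a (Finset.mem_insert_self a S)) y)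
      (differentiableAt_comp_symm_of_contMDiff (contMDiff_finsetSum hS) y), ih hS]

omit [DecidableEq ι] in
/-- Additivity of `∂_v` over finite sums of smooth functions. [folklore] -/
theorem del_finset_sum {α : Type*} (S : Finset α) {f : α → D → ℂ} (hf : ∀ a ∈ S, ContMDiff 𝓘(ℝ, ι → ℂ) 𝓘(ℝ, ℂ) ∞ (f a))
    (v : ι → ℂ) (y : D) : del v (fun y ↦ ∑ a ∈ S, f a y) y = ∑ a ∈ S, del v (f a) y := by
  classical
  induction S using Finset.induction_on with
  | empty => simp [del_const]
  | insert a S ha ih =>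
    have hS : ∀ b ∈ S, ContMDiff 𝓘(ℝ, ι → ℂ) 𝓘(ℝ, ℂ) ∞ (f b) := fun b hb ↦ hf b (Finset.mem_insert_of_mem hb)
    simp only [Finset.sum_insert ha]
    have h1 : (fun y ↦ f a y + ∑ b ∈ S, f b y) = f a + fun y ↦ ∑ b ∈ S, f b y := rfl
    rw [h1, del_add (differentiableAt_comp_symm_of_contMDiff (hf a (Finset.mem_insert_self a S)) y)
      (differentiableAt_comp_symm_of_contMDiff (contMDiff_finsetSum hS) y), ih hS]

omit [DecidableEq ι] in
/-- The complexified `N + ε²` as `∑ conj(W_k) W_k + ε²`. [folklore] -/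
theorem distSq_add_eq (ε : ℝ) (y : D) :
    ((D.distSq z₀ y + ε ^ 2 : ℝ) : ℂ) = ∑ k, conj (D.coordFn z₀ k y) * D.coordFn z₀ k y + (ε : ℂ) ^ 2 := by
  simp only [distSq, ofReal_add, ofReal_sum, ofReal_pow]
  congr 1
  exact Finset.sum_congr rfl fun k _ ↦ by rw [conj_mul']

omit [DecidableEq ι] in
/-- Conjugates of smooth functions are smooth. [folklore] -/
theorem contMDiff_conj_comp {f : D → ℂ} (hf : ContMDiff 𝓘(ℝ, ι → ℂ) 𝓘(ℝ, ℂ) ∞ f) :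
    ContMDiff 𝓘(ℝ, ι → ℂ) 𝓘(ℝ, ℂ) ∞ fun y ↦ conj (f y) :=
  conjCLE.contDiff.comp_contMDiff hf

omit [DecidableEq ι] in
/-- The complexified `N + ε²` is `C^∞`. [folklore] -/
theorem contMDiff_distSq_add (ε : ℝ) : ContMDiff 𝓘(ℝ, ι → ℂ) 𝓘(ℝ, ℂ) ∞ fun y ↦ ((D.distSq z₀ y + ε ^ 2 : ℝ) : ℂ) :=
  contMDiff_ofReal ((contMDiff_distSq z₀).add contMDiff_const)

omit [DecidableEq ι] in
/-- `∂̄_v (N + ε²) = ∑_k W_k conj(v_k)`. [folklore] -/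
theorem dbar_distSq (ε : ℝ) (v : ι → ℂ) (y : D) :
    dbar v (fun y ↦ ((D.distSq z₀ y + ε ^ 2 : ℝ) : ℂ)) y = ∑ k, D.coordFn z₀ k y * conj (v k) := by
  have hfun : (fun y ↦ ((D.distSq z₀ y + ε ^ 2 : ℝ) : ℂ)) =
      (fun y ↦ ∑ k, conj (D.coordFn z₀ k y) * D.coordFn z₀ k y) + fun _ ↦ (ε : ℂ) ^ 2 := by
    funext y; rw [distSq_add_eq]; rfl
  have hterm : ∀ k, ContMDiff 𝓘(ℝ, ι → ℂ) 𝓘(ℝ, ℂ) ∞ fun y ↦ conj (D.coordFn z₀ k y) * D.coordFn z₀ k y := fun k ↦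
    contMDiff_mul (contMDiff_conj_comp (contMDiff_coordFn z₀ k)) (contMDiff_coordFn z₀ k)
  rw [hfun, dbar_add (differentiableAt_comp_symm_of_contMDiff (contMDiff_finsetSum fun k _ ↦ hterm k) y)
    (differentiableAt_comp_symm_of_contMDiff contMDiff_const y), dbar_const, add_zero,
    dbar_finset_sum _ (fun k _ ↦ hterm k)]
  refine Finset.sum_congr rfl fun k _ ↦ ?_
  rw [dbar_mul_apply (contMDiff_conj_comp (contMDiff_coordFn z₀ k)) (contMDiff_coordFn z₀ k), dbar_coordFn,
    mul_zero, zero_add, dbar_conj_coordFn]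
  ring

omit [DecidableEq ι] in
/-- `∂_v (N + ε²) = ∑_k conj(W_k) v_k`. [folklore] -/
theorem del_distSq (ε : ℝ) (v : ι → ℂ) (y : D) :
    del v (fun y ↦ ((D.distSq z₀ y + ε ^ 2 : ℝ) : ℂ)) y = ∑ k, conj (D.coordFn z₀ k y) * v k := by
  have hfun : (fun y ↦ ((D.distSq z₀ y + ε ^ 2 : ℝ) : ℂ)) =
      (fun y ↦ ∑ k, conj (D.coordFn z₀ k y) * D.coordFn z₀ k y) + fun _ ↦ (ε : ℂ) ^ 2 := by
    funext y; rw [distSq_add_eq]; rfl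
  have hterm : ∀ k, ContMDiff 𝓘(ℝ, ι → ℂ) 𝓘(ℝ, ℂ) ∞ fun y ↦ conj (D.coordFn z₀ k y) * D.coordFn z₀ k y := fun k ↦
    contMDiff_mul (contMDiff_conj_comp (contMDiff_coordFn z₀ k)) (contMDiff_coordFn z₀ k)
  rw [hfun, del_add (differentiableAt_comp_symm_of_contMDiff (contMDiff_finsetSum fun k _ ↦ hterm k) y)
    (differentiableAt_comp_symm_of_contMDiff contMDiff_const y), del_const, add_zero,
    del_finset_sum _ (fun k _ ↦ hterm k)]
  refine Finset.sum_congr rfl fun k _ ↦ ?_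
  rw [del_mul_apply (contMDiff_conj_comp (contMDiff_coordFn z₀ k)) (contMDiff_coordFn z₀ k), del_coordFn,
    del_conj_coordFn, zero_mul, add_zero]

omit [DecidableEq ι] in
/-- Pointwise chain rule `∂̄_v (χ ∘ u) = χ'(u) ∂̄_v u` (differentiability of `χ` at `u x` only). [folklore] -/
theorem dbar_ofReal_comp_at {χ : ℝ → ℝ} {u : D → ℝ} (hu : ContMDiff 𝓘(ℝ, ι → ℂ) 𝓘(ℝ, ℝ) ∞ u) {x : D}
    (hχ : DifferentiableAt ℝ χ (u x)) (v : ι → ℂ) :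
    dbar v (fun y ↦ (χ (u y) : ℂ)) x = ((deriv χ (u x) : ℝ) : ℂ) * dbar v (fun y ↦ (u y : ℂ)) x := by
  have hU : DifferentiableAt ℝ (u ∘ (D.chart x).symm) (D.proj x) :=
    (contMDiffAt_iff_contDiffAt.1 (hu x)).differentiableAt (by simp)
  have hux : (u ∘ (D.chart x).symm) (D.proj x) = u x := by simp only [comp_apply, D.chart_symm_proj]
  rw [dbar, dbar]
  have h1 : ((fun y ↦ (χ (u y) : ℂ)) ∘ (D.chart x).symm) = fun z ↦ (χ ((u ∘ (D.chart x).symm) z) : ℂ) := rfl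
  have h2 : ((fun y ↦ (u y : ℂ)) ∘ (D.chart x).symm) = fun z ↦ ((u ∘ (D.chart x).symm) z : ℂ) := rfl
  rw [h1, h2, dbarAlong_ofReal_comp (by rw [hux]; exact hχ) hU, hux]

omit [DecidableEq ι] in
/-- Pointwise chain rule `∂_v (χ ∘ u) = χ'(u) ∂_v u`. [folklore] -/
theorem del_ofReal_comp_at {χ : ℝ → ℝ} {u : D → ℝ} (hu : ContMDiff 𝓘(ℝ, ι → ℂ) 𝓘(ℝ, ℝ) ∞ u) {x : D}
    (hχ : DifferentiableAt ℝ χ (u x)) (v : ι → ℂ) :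
    del v (fun y ↦ (χ (u y) : ℂ)) x = ((deriv χ (u x) : ℝ) : ℂ) * del v (fun y ↦ (u y : ℂ)) x := by
  have hU : DifferentiableAt ℝ (u ∘ (D.chart x).symm) (D.proj x) :=
    (contMDiffAt_iff_contDiffAt.1 (hu x)).differentiableAt (by simp)
  have hux : (u ∘ (D.chart x).symm) (D.proj x) = u x := by simp only [comp_apply, D.chart_symm_proj]
  rw [del, del]
  have h1 : ((fun y ↦ (χ (u y) : ℂ)) ∘ (D.chart x).symm) = fun z ↦ (χ ((u ∘ (D.chart x).symm) z) : ℂ) := rfl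
  have h2 : ((fun y ↦ (u y : ℂ)) ∘ (D.chart x).symm) = fun z ↦ ((u ∘ (D.chart x).symm) z : ℂ) := rfl
  rw [h1, h2, delAlong_ofReal_comp (by rw [hux]; exact hχ) hU, hux]

variable {z₀}

omit [DecidableEq ι] in
/-- **`∂̄_v f_ε = (N + ε²)⁻¹ ∑_k W_k conj(v_k)`.** [folklore] -/
theorem dbar_pointWeight {ε : ℝ} (hε : ε ≠ 0) (v : ι → ℂ) (y : D) :
    dbar v (fun y ↦ (D.pointWeight z₀ ε y : ℂ)) y =
      (((D.distSq z₀ y + ε ^ 2)⁻¹ : ℝ) : ℂ) * ∑ k, D.coordFn z₀ k y * conj (v k) := by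
  have hq : ContMDiff 𝓘(ℝ, ι → ℂ) 𝓘(ℝ, ℝ) ∞ fun y ↦ D.distSq z₀ y + ε ^ 2 := (contMDiff_distSq z₀).add contMDiff_const
  have h := dbar_ofReal_comp_at (χ := Real.log) hq (Real.differentiableAt_log (distSq_add_sq_pos z₀ hε y).ne') v (x := y)
  simp only [pointWeight]
  rw [h, Real.deriv_log, dbar_distSq]

omit [DecidableEq ι] in
/-- **`∂̄_v f_ε` as a function.** [folklore] -/
theorem dbar_pointWeight_eq {ε : ℝ} (hε : ε ≠ 0) (v : ι → ℂ) :
    dbar v (fun y ↦ (D.pointWeight z₀ ε y : ℂ)) =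
      fun y ↦ (((D.distSq z₀ y + ε ^ 2)⁻¹ : ℝ) : ℂ) * ∑ k, D.coordFn z₀ k y * conj (v k) :=
  funext fun y ↦ dbar_pointWeight hε v y

omit [DecidableEq ι] in
/-- `(N + ε²)⁻¹` is `C^∞` for `ε ≠ 0`. [folklore] -/
theorem contMDiff_distSq_inv {ε : ℝ} (hε : ε ≠ 0) :
    ContMDiff 𝓘(ℝ, ι → ℂ) 𝓘(ℝ, ℝ) ∞ fun y ↦ (D.distSq z₀ y + ε ^ 2)⁻¹ := by
  rw [contMDiff_iff]
  intro x
  have hN := (contMDiff_iff.1 (contMDiff_distSq (D := D) z₀)) x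
  have : (fun y ↦ (D.distSq z₀ y + ε ^ 2)⁻¹) ∘ (D.chart x).symm = fun z ↦ ((D.distSq z₀ ∘ (D.chart x).symm) z + ε ^ 2)⁻¹ := rfl
  rw [this]
  exact (hN.add contDiffOn_const).inv fun z _ ↦ (distSq_add_sq_pos z₀ hε _).ne'

omit [DecidableEq ι] in
/-- **The Levi form of `f_ε`**:
`∂_a ∂̄_b f_ε = (N+ε²)⁻¹ ∑_k a_k conj(b_k) - (N+ε²)⁻² (∑_k conj(W_k) a_k)(∑_k W_k conj(b_k))`. [cite: HormanderSCV1973, Thm 4.4.3 (proof)] -/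
theorem del_dbar_pointWeight {ε : ℝ} (hε : ε ≠ 0) (a b : ι → ℂ) (y : D) :
    del a (dbar b (fun y ↦ (D.pointWeight z₀ ε y : ℂ))) y =
      (((D.distSq z₀ y + ε ^ 2)⁻¹ : ℝ) : ℂ) * ∑ k, a k * conj (b k) -
        (((D.distSq z₀ y + ε ^ 2)⁻¹ : ℝ) : ℂ) ^ 2 * (∑ k, conj (D.coordFn z₀ k y) * a k) * ∑ k, D.coordFn z₀ k y * conj (b k) := by
  rw [dbar_pointWeight_eq hε]
  have hw : ContMDiff 𝓘(ℝ, ι → ℂ) 𝓘(ℝ, ℂ) ∞ fun y ↦ ∑ k, D.coordFn z₀ k y * conj (b k) :=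
    contMDiff_finsetSum fun k _ ↦ contMDiff_mul (contMDiff_coordFn z₀ k) contMDiff_const
  have hχ : ContMDiff 𝓘(ℝ, ι → ℂ) 𝓘(ℝ, ℂ) ∞ fun y ↦ (((D.distSq z₀ y + ε ^ 2)⁻¹ : ℝ) : ℂ) :=
    contMDiff_ofReal (contMDiff_distSq_inv hε)
  rw [del_mul_apply hχ hw]
  -- `∂_a ∑ W_k conj(b_k) = ∑ a_k conj(b_k)`
  have h1 : del a (fun y ↦ ∑ k, D.coordFn z₀ k y * conj (b k)) y = ∑ k, a k * conj (b k) := by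
    rw [del_finset_sum _ (fun k _ ↦ contMDiff_mul (contMDiff_coordFn z₀ k) contMDiff_const)]
    refine Finset.sum_congr rfl fun k _ ↦ ?_
    rw [del_mul_apply (contMDiff_coordFn z₀ k) contMDiff_const, del_const, mul_zero, zero_add, del_coordFn]
  -- `∂_a (N+ε²)⁻¹ = -(N+ε²)⁻² ∑ conj(W_k) a_k`
  have h2 : del a (fun y ↦ (((D.distSq z₀ y + ε ^ 2)⁻¹ : ℝ) : ℂ)) y =
      -((((D.distSq z₀ y + ε ^ 2)⁻¹ : ℝ) : ℂ) ^ 2) * ∑ k, conj (D.coordFn z₀ k y) * a k := by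
    have hq := (distSq_add_sq_pos z₀ hε y).ne'
    have hqs : ContMDiff 𝓘(ℝ, ι → ℂ) 𝓘(ℝ, ℝ) ∞ fun y ↦ D.distSq z₀ y + ε ^ 2 := (contMDiff_distSq z₀).add contMDiff_const
    have h := del_ofReal_comp_at (χ := fun t : ℝ ↦ t⁻¹) hqs (differentiableAt_inv hq) a (x := y)
    rw [h, deriv_inv, del_distSq]
    congr 1
    push_cast
    field_simp
  rw [h1, h2]
  ring

/-- The Levi matrix of `f_ε` in coordinates:
`∂_j ∂̄_k f_ε = (N+ε²)⁻¹ δ_{jk} - (N+ε²)⁻² conj(W_j) W_k`. [cite: HormanderSCV1973, Thm 4.4.3 (proof)] -/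
theorem del_dbar_pointWeight_single {ε : ℝ} (hε : ε ≠ 0) (j k : ι) (y : D) :
    del (Pi.single j 1) (dbar (Pi.single k 1) (fun y ↦ (D.pointWeight z₀ ε y : ℂ))) y =
      (((D.distSq z₀ y + ε ^ 2)⁻¹ : ℝ) : ℂ) * (if j = k then 1 else 0) -
        (((D.distSq z₀ y + ε ^ 2)⁻¹ : ℝ) : ℂ) ^ 2 * conj (D.coordFn z₀ j y) * D.coordFn z₀ k y := by
  rw [del_dbar_pointWeight hε]
  have hsingle : ∑ i, (Pi.single j (1 : ℂ) : ι → ℂ) i * conj ((Pi.single k (1 : ℂ) : ι → ℂ) i) = if j = k then 1 else 0 := by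
    rw [Finset.sum_eq_single j (fun i _ hi ↦ by rw [Pi.single_eq_of_ne hi, zero_mul]) (fun h ↦ (h (Finset.mem_univ _)).elim),
      Pi.single_eq_same, one_mul]
    by_cases hjk : j = k
    · subst hjk; rw [Pi.single_eq_same, map_one, if_pos rfl]
    · rw [Pi.single_eq_of_ne hjk, map_zero, if_neg hjk]
  have hA : ∑ i, conj (D.coordFn z₀ i y) * (Pi.single j (1 : ℂ) : ι → ℂ) i = conj (D.coordFn z₀ j y) := by
    rw [Finset.sum_eq_single j (fun i _ hi ↦ by rw [Pi.single_eq_of_ne hi, mul_zero]) (fun h ↦ (h (Finset.mem_univ _)).elim),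
      Pi.single_eq_same, mul_one]
  have hB : ∑ i, D.coordFn z₀ i y * conj ((Pi.single k (1 : ℂ) : ι → ℂ) i) = D.coordFn z₀ k y := by
    rw [Finset.sum_eq_single k (fun i _ hi ↦ by rw [Pi.single_eq_of_ne hi, map_zero, mul_zero]) (fun h ↦ (h (Finset.mem_univ _)).elim),
      Pi.single_eq_same, map_one, mul_one]
  rw [hsingle, hA, hB, mul_assoc]

/-- **Plurisubharmonicity of the point weight**: `Re ∑ ∂_j ∂̄_k f_ε v_j v̄_k ≥ 0` (Cauchy–Schwarz:
the form equals `(|v|²(N+ε²) - |∑ W_k v̄_k|²)/(N+ε²)² ≥ ε² |v|²/(N+ε²)²`). [cite: HormanderSCV1973, Thm 4.4.3 (proof: `log|z|` is plurisubharmonic)] -/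
theorem re_levi_pointWeight_nonneg {ε : ℝ} (hε : ε ≠ 0) (y : D) (v : ι → ℂ) :
    0 ≤ (∑ j, ∑ k, del (Pi.single j 1) (dbar (Pi.single k 1) (fun y ↦ (D.pointWeight z₀ ε y : ℂ))) y * v j * conj (v k)).re := by
  simp_rw [del_dbar_pointWeight_single hε]
  have hq0 : 0 < (D.distSq z₀ y + ε ^ 2)⁻¹ := inv_pos.2 (distSq_add_sq_pos z₀ hε y)
  -- evaluate the double sum
  have hsum : ∑ j, ∑ k, ((((D.distSq z₀ y + ε ^ 2)⁻¹ : ℝ) : ℂ) * (if j = k then 1 else 0) -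
      (((D.distSq z₀ y + ε ^ 2)⁻¹ : ℝ) : ℂ) ^ 2 * conj (D.coordFn z₀ j y) * D.coordFn z₀ k y) * v j * conj (v k) =
      (((D.distSq z₀ y + ε ^ 2)⁻¹ : ℝ) : ℂ) * ∑ j, v j * conj (v j) -
        (((D.distSq z₀ y + ε ^ 2)⁻¹ : ℝ) : ℂ) ^ 2 *
          (conj (∑ k, D.coordFn z₀ k y * conj (v k)) * ∑ k, D.coordFn z₀ k y * conj (v k)) := by
    have e1 : ∀ j, ∑ k, ((((D.distSq z₀ y + ε ^ 2)⁻¹ : ℝ) : ℂ) * (if j = k then 1 else 0) -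
        (((D.distSq z₀ y + ε ^ 2)⁻¹ : ℝ) : ℂ) ^ 2 * conj (D.coordFn z₀ j y) * D.coordFn z₀ k y) * v j * conj (v k) =
        (((D.distSq z₀ y + ε ^ 2)⁻¹ : ℝ) : ℂ) * (v j * conj (v j)) -
          (((D.distSq z₀ y + ε ^ 2)⁻¹ : ℝ) : ℂ) ^ 2 * (conj (D.coordFn z₀ j y * conj (v j)) * ∑ k, D.coordFn z₀ k y * conj (v k)) := by
      intro j
      rw [Finset.sum_congr rfl fun k _ ↦ show ((((D.distSq z₀ y + ε ^ 2)⁻¹ : ℝ) : ℂ) * (if j = k then 1 else 0) -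
          (((D.distSq z₀ y + ε ^ 2)⁻¹ : ℝ) : ℂ) ^ 2 * conj (D.coordFn z₀ j y) * D.coordFn z₀ k y) * v j * conj (v k) =
          (((D.distSq z₀ y + ε ^ 2)⁻¹ : ℝ) : ℂ) * ((if j = k then 1 else 0) * v j * conj (v k)) -
            (((D.distSq z₀ y + ε ^ 2)⁻¹ : ℝ) : ℂ) ^ 2 * (conj (D.coordFn z₀ j y) * v j * (D.coordFn z₀ k y * conj (v k))) by ring,
        Finset.sum_sub_distrib, ← Finset.mul_sum, ← Finset.mul_sum, ← Finset.mul_sum, map_mul, conj_conj]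
      congr 2
      rw [Finset.sum_eq_single j (fun k _ hk ↦ by rw [if_neg (Ne.symm hk)]; ring) (fun h ↦ (h (Finset.mem_univ _)).elim), if_pos rfl]
      ring
    simp_rw [e1]
    rw [Finset.sum_sub_distrib, ← Finset.mul_sum, ← Finset.mul_sum, ← Finset.sum_mul, _root_.map_sum]
  rw [hsum]
  -- real parts
  have hvv : ∑ j, v j * conj (v j) = ((∑ j, ‖v j‖ ^ 2 : ℝ) : ℂ) := by
    rw [ofReal_sum]; exact Finset.sum_congr rfl fun j _ ↦ by rw [mul_conj', ofReal_pow]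
  rw [hvv, conj_mul', ← ofReal_pow, ← ofReal_pow, ← ofReal_mul, ← ofReal_mul, ← ofReal_sub, ofReal_re]
  -- Cauchy–Schwarz: `‖P‖² ≤ N |v|²` and `q N ≤ 1`
  have hCS : ‖∑ k, D.coordFn z₀ k y * conj (v k)‖ ^ 2 ≤ (∑ k, ‖D.coordFn z₀ k y‖ ^ 2) * ∑ k, ‖v k‖ ^ 2 := by
    have := norm_sum_mul_sq_le (fun k ↦ D.coordFn z₀ k y) (fun k ↦ conj (v k))
    simpa only [norm_conj] using this
  have hN : (∑ k, ‖D.coordFn z₀ k y‖ ^ 2) = D.distSq z₀ y := rfl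
  have hqN : (D.distSq z₀ y + ε ^ 2)⁻¹ * D.distSq z₀ y ≤ 1 := by
    rw [inv_mul_le_iff₀ (distSq_add_sq_pos z₀ hε y)]
    nlinarith [sq_nonneg ε]
  have hv0 : 0 ≤ ∑ k, ‖v k‖ ^ 2 := Finset.sum_nonneg fun _ _ ↦ sq_nonneg _
  rw [hN] at hCS
  nlinarith [mul_le_mul_of_nonneg_left hCS (sq_nonneg (D.distSq z₀ y + ε ^ 2)⁻¹),
    mul_le_mul_of_nonneg_right hqN (mul_nonneg hq0.le hv0)]

/-- **Strict plurisubharmonicity of the point weight**, quantitatively: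
`Re ∑ ∂_j ∂̄_k f_ε v_j v̄_k ≥ ε² |v|² / (N + ε²)²`. [cite: HormanderSCV1973, Thm 4.4.3 (proof)] -/
theorem re_levi_pointWeight_ge {ε : ℝ} (hε : ε ≠ 0) (y : D) (v : ι → ℂ) :
    ε ^ 2 * (D.distSq z₀ y + ε ^ 2)⁻¹ ^ 2 * ∑ j, ‖v j‖ ^ 2 ≤
      (∑ j, ∑ k, del (Pi.single j 1) (dbar (Pi.single k 1) (fun y ↦ (D.pointWeight z₀ ε y : ℂ))) y * v j * conj (v k)).re := by
  simp_rw [del_dbar_pointWeight_single hε]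
  have hpos := distSq_add_sq_pos z₀ hε y
  have hq0 : 0 < (D.distSq z₀ y + ε ^ 2)⁻¹ := inv_pos.2 hpos
  -- evaluate the double sum (as in `re_levi_pointWeight_nonneg`)
  have hsum : ∑ j, ∑ k, ((((D.distSq z₀ y + ε ^ 2)⁻¹ : ℝ) : ℂ) * (if j = k then 1 else 0) -
      (((D.distSq z₀ y + ε ^ 2)⁻¹ : ℝ) : ℂ) ^ 2 * conj (D.coordFn z₀ j y) * D.coordFn z₀ k y) * v j * conj (v k) =
      (((D.distSq z₀ y + ε ^ 2)⁻¹ : ℝ) : ℂ) * ∑ j, v j * conj (v j) -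
        (((D.distSq z₀ y + ε ^ 2)⁻¹ : ℝ) : ℂ) ^ 2 *
          (conj (∑ k, D.coordFn z₀ k y * conj (v k)) * ∑ k, D.coordFn z₀ k y * conj (v k)) := by
    have e1 : ∀ j, ∑ k, ((((D.distSq z₀ y + ε ^ 2)⁻¹ : ℝ) : ℂ) * (if j = k then 1 else 0) -
        (((D.distSq z₀ y + ε ^ 2)⁻¹ : ℝ) : ℂ) ^ 2 * conj (D.coordFn z₀ j y) * D.coordFn z₀ k y) * v j * conj (v k) =
        (((D.distSq z₀ y + ε ^ 2)⁻¹ : ℝ) : ℂ) * (v j * conj (v j)) -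
          (((D.distSq z₀ y + ε ^ 2)⁻¹ : ℝ) : ℂ) ^ 2 * (conj (D.coordFn z₀ j y * conj (v j)) * ∑ k, D.coordFn z₀ k y * conj (v k)) := by
      intro j
      rw [Finset.sum_congr rfl fun k _ ↦ show ((((D.distSq z₀ y + ε ^ 2)⁻¹ : ℝ) : ℂ) * (if j = k then 1 else 0) -
          (((D.distSq z₀ y + ε ^ 2)⁻¹ : ℝ) : ℂ) ^ 2 * conj (D.coordFn z₀ j y) * D.coordFn z₀ k y) * v j * conj (v k) =
          (((D.distSq z₀ y + ε ^ 2)⁻¹ : ℝ) : ℂ) * ((if j = k then 1 else 0) * v j * conj (v k)) -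
            (((D.distSq z₀ y + ε ^ 2)⁻¹ : ℝ) : ℂ) ^ 2 * (conj (D.coordFn z₀ j y) * v j * (D.coordFn z₀ k y * conj (v k))) by ring,
        Finset.sum_sub_distrib, ← Finset.mul_sum, ← Finset.mul_sum, ← Finset.mul_sum, map_mul, conj_conj]
      congr 2
      rw [Finset.sum_eq_single j (fun k _ hk ↦ by rw [if_neg (Ne.symm hk)]; ring) (fun h ↦ (h (Finset.mem_univ _)).elim), if_pos rfl]
      ring
    simp_rw [e1]
    rw [Finset.sum_sub_distrib, ← Finset.mul_sum, ← Finset.mul_sum, ← Finset.sum_mul, _root_.map_sum]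
  rw [hsum]
  have hvv : ∑ j, v j * conj (v j) = ((∑ j, ‖v j‖ ^ 2 : ℝ) : ℂ) := by
    rw [ofReal_sum]; exact Finset.sum_congr rfl fun j _ ↦ by rw [mul_conj', ofReal_pow]
  rw [hvv, conj_mul', ← ofReal_pow, ← ofReal_pow, ← ofReal_mul, ← ofReal_mul, ← ofReal_sub, ofReal_re]
  have hCS : ‖∑ k, D.coordFn z₀ k y * conj (v k)‖ ^ 2 ≤ (∑ k, ‖D.coordFn z₀ k y‖ ^ 2) * ∑ k, ‖v k‖ ^ 2 := by
    have := norm_sum_mul_sq_le (fun k ↦ D.coordFn z₀ k y) (fun k ↦ conj (v k))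
    simpa only [norm_conj] using this
  have hN : (∑ k, ‖D.coordFn z₀ k y‖ ^ 2) = D.distSq z₀ y := rfl
  rw [hN] at hCS
  have hq1 : (D.distSq z₀ y + ε ^ 2)⁻¹ * (D.distSq z₀ y + ε ^ 2) = 1 := inv_mul_cancel₀ hpos.ne'
  have hv0 : 0 ≤ ∑ k, ‖v k‖ ^ 2 := Finset.sum_nonneg fun _ _ ↦ sq_nonneg _
  have hkey : (D.distSq z₀ y + ε ^ 2)⁻¹ * ∑ k, ‖v k‖ ^ 2 -
      (D.distSq z₀ y + ε ^ 2)⁻¹ ^ 2 * (D.distSq z₀ y * ∑ k, ‖v k‖ ^ 2) =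
      ε ^ 2 * (D.distSq z₀ y + ε ^ 2)⁻¹ ^ 2 * ∑ k, ‖v k‖ ^ 2 := by
    linear_combination (-((D.distSq z₀ y + ε ^ 2)⁻¹ * ∑ k, ‖v k‖ ^ 2)) * hq1
  nlinarith [mul_le_mul_of_nonneg_left hCS (sq_nonneg (D.distSq z₀ y + ε ^ 2)⁻¹)]

end PointWeight

/-! ### Sheets over a polydisc and the cut-offs `χ_i` -/

section Sheets

omit [DecidableEq ι] in
/-- **Disjoint sheets through finitely many points of one fibre.** For distinct points
`t₁, …, t_N` with `proj tᵢ = z₀` there are local inverses `eᵢ` of `proj` with pairwise disjoint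
sources, `tᵢ ∈ eᵢ.source`, and a common polydisc `B̄(z₀, 3r) ⊆ eᵢ.target`. [folklore] -/
theorem exists_sheets {N : ℕ} {t : Fin N → D} (ht : Function.Injective t) {z₀ : ι → ℂ} (htz : ∀ i, D.proj (t i) = z₀) :
    ∃ (e : Fin N → OpenPartialHomeomorph D (ι → ℂ)) (r : ℝ), 0 < r ∧ (∀ i, ⇑(e i) = D.proj) ∧ (∀ i, t i ∈ (e i).source) ∧
      (∀ i, closedBall z₀ (3 * r) ⊆ (e i).target) ∧ Pairwise fun i j ↦ Disjoint (e i).source (e j).source := by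
  obtain ⟨U, hU, hdisj⟩ := (Set.finite_range t).t2_separation
  set e : Fin N → OpenPartialHomeomorph D (ι → ℂ) := fun i ↦ (D.chart (t i)).restrOpen (U (t i)) (hU (t i)).2 with he
  have hecoe : ∀ i, ⇑(e i) = D.proj := fun i ↦ by rw [he]; simp
  have hesrc : ∀ i, (e i).source = (D.chart (t i)).source ∩ U (t i) := fun i ↦ OpenPartialHomeomorph.restrOpen_source _ _ _
  have hmem : ∀ i, t i ∈ (e i).source := fun i ↦ by rw [hesrc]; exact ⟨D.mem_chart_source _, (hU (t i)).1⟩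
  have hz₀ : ∀ i, z₀ ∈ (e i).target := fun i ↦ by
    rw [← htz i, ← hecoe i]; exact (e i).map_source (hmem i)
  -- a common polydisc
  have hopen : IsOpen (⋂ i, (e i).target) := isOpen_iInter_of_finite fun i ↦ (e i).open_target
  obtain ⟨ε, hε, hεt⟩ := Metric.isOpen_iff.1 hopen z₀ (mem_iInter.2 hz₀)
  refine ⟨e, ε / 4, by positivity, hecoe, hmem, fun i ↦ ?_, fun i j hij ↦ ?_⟩
  · exact (closedBall_subset_ball (by linarith)).trans (hεt.trans (iInter_subset _ i))
  · show Disjoint (e i).source (e j).source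
    rw [hesrc, hesrc]
    have hne : t i ≠ t j := fun h ↦ hij (ht h)
    exact (hdisj (mem_range_self i) (mem_range_self j) hne).mono inter_subset_right inter_subset_right

omit [DecidableEq ι] in
/-- If `u` is locally constant near `x` then `∂̄_v u (x) = 0`. [folklore] -/
theorem dbar_eq_zero_of_eventuallyEq_const {u : D → ℂ} {x : D} {c : ℂ} (h : u =ᶠ[𝓝 x] fun _ ↦ c) (v : ι → ℂ) :
    dbar v u x = 0 := by
  rw [dbar_eq_fderivF, fderivF_eq_zero_of_eventuallyEq_const h]; simp

omit [DecidableEq ι] in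
/-- The sup distance to `z₀` is dominated by `N`: `‖proj y - z₀‖² ≤ N(y)`. [folklore] -/
theorem norm_sub_sq_le_distSq (z₀ : ι → ℂ) (y : D) : ‖D.proj y - z₀‖ ^ 2 ≤ D.distSq z₀ y :=
  PointWeightSCV.norm_sq_le_euclidSq (D.proj y - z₀)

omit [DecidableEq ι] in
/-- **The cut-off datum**: given disjoint sheets over `B̄(z₀, 3r)` and values `cᵢ`, a test function
`u₀` with `u₀ = cᵢ` on `Oᵢ = eᵢ.source ∩ proj⁻¹ B(z₀, r)`, and `∂̄ u₀` supported where `N ≥ r²`.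
[cite: HormanderSCV1973, Thm 4.4.3 (proof: the cut-off `ψ`)] -/
theorem exists_cutoff_datum {N : ℕ} (e : Fin N → OpenPartialHomeomorph D (ι → ℂ)) {z₀ : ι → ℂ} {r : ℝ} (hr : 0 < r)
    (he : ∀ i, ⇑(e i) = D.proj) (het : ∀ i, closedBall z₀ (3 * r) ⊆ (e i).target)
    (hdisj : Pairwise fun i j ↦ Disjoint (e i).source (e j).source) (c : Fin N → ℂ) :
    ∃ u₀ : D → ℂ, IsTest u₀ ∧
      (∀ i, ∀ y ∈ (e i).source, D.proj y ∈ ball z₀ r → u₀ =ᶠ[𝓝 y] fun _ ↦ c i) ∧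
      (∀ (y : D) (v : ι → ℂ), dbar v u₀ y ≠ 0 → r ^ 2 ≤ D.distSq z₀ y) := by
  classical
  -- the bump and the cut-offs
  let ρ : ContDiffBump z₀ := ⟨r, 2 * r, hr, by linarith⟩
  set W : (ι → ℂ) → ℂ := fun z ↦ ((ρ z : ℝ) : ℂ) with hW
  have hWs : ContDiff ℝ ∞ W := ofRealCLM.contDiff.comp ρ.contDiff
  have hWc : HasCompactSupport W := ρ.hasCompactSupport.comp_left ofReal_zero
  have hWsupp : tsupport W ⊆ closedBall z₀ (2 * r) := by
    refine closure_minimal (fun z hz ↦ ?_) isClosed_closedBall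
    have : ρ z ≠ 0 := by simpa [hW] using hz
    exact ρ.tsupport_eq ▸ subset_tsupport _ (mem_support.2 this)
  have hWe : ∀ i, tsupport W ⊆ (e i).target := fun i ↦ hWsupp.trans ((closedBall_subset_closedBall (by linarith)).trans (het i))
  set χ : Fin N → D → ℂ := fun i ↦ (e i).source.indicator (W ∘ D.proj) with hχ
  have hχtest : ∀ i, IsTest (χ i) ∧ tsupport (χ i) ⊆ (e i).source := fun i ↦ isTest_indicator_comp_proj (he i) hWs hWc (hWe i)
  -- the datum
  set u₀ : D → ℂ := fun y ↦ ∑ i, c i * χ i y with hu₀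
  have hu₀t : IsTest u₀ := IsTest.sum fun i _ ↦ (hχtest i).1.mul_left contMDiff_const
  -- `u₀ = c_i` near points of `O_i`
  have hloc : ∀ i, ∀ y ∈ (e i).source, D.proj y ∈ ball z₀ r → u₀ =ᶠ[𝓝 y] fun _ ↦ c i := by
    intro i y hy hyb
    have hO : IsOpen ((e i).source ∩ D.proj ⁻¹' ball z₀ r) :=
      (e i).open_source.inter (isOpen_ball.preimage D.isLocalHomeomorph.continuous)
    filter_upwards [hO.mem_nhds ⟨hy, hyb⟩] with y' hy'
    simp only [hu₀]
    rw [Finset.sum_eq_single i (fun j _ hji ↦ ?_) (fun h ↦ (h (Finset.mem_univ _)).elim)]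
    · simp only [hχ, indicator_of_mem hy'.1, comp_apply, hW]
      rw [ρ.one_of_mem_closedBall (ball_subset_closedBall hy'.2), ofReal_one, mul_one]
    · have : y' ∉ (e j).source := fun h ↦ (hdisj hji).le_bot ⟨h, hy'.1⟩
      simp only [hχ, indicator_of_notMem this, mul_zero]
  refine ⟨u₀, hu₀t, hloc, fun y v hv ↦ ?_⟩
  -- where `∂̄ u₀ ≠ 0`: some `χ_i` is supported at `y`, and `proj y ∉ B(z₀, r)`
  by_contra hlt
  rw [not_le] at hlt
  have hyb : D.proj y ∈ ball z₀ r := by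
    rw [mem_ball, dist_eq_norm]
    have h1 := norm_sub_sq_le_distSq (D := D) z₀ y
    nlinarith [norm_nonneg (D.proj y - z₀)]
  by_cases hi : ∃ i, y ∈ (e i).source
  · obtain ⟨i, hyi⟩ := hi
    exact hv (dbar_eq_zero_of_eventuallyEq_const (hloc i y hyi hyb) v)
  · push Not at hi
    -- all `χ_i` vanish near `y`
    have hev : u₀ =ᶠ[𝓝 y] fun _ ↦ 0 := by
      have hχ0 : ∀ i, χ i =ᶠ[𝓝 y] 0 := fun i ↦ by
        have hyi : y ∉ tsupport (χ i) := fun h ↦ hi i ((hχtest i).2 h)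
        exact notMem_tsupport_iff_eventuallyEq.1 hyi
      have hall : ∀ᶠ y' in 𝓝 y, ∀ i, χ i y' = 0 := by
        rw [eventually_all]
        exact fun i ↦ (hχ0 i).mono fun y' hy' ↦ hy'
      filter_upwards [hall] with y' hy'
      simp only [hu₀, hy', mul_zero, Finset.sum_const_zero]
    exact hv (dbar_eq_zero_of_eventuallyEq_const hev v)

end Sheets

/-! ### The interpolation theorem -/

section Interpolation

open Weights PointWeightSCV

omit [DecidableEq ι] in
/-- `eLpNorm ≤ M` from `∫⁻ |u|² e^{-φ} ≤ M²`. [folklore] -/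
theorem eLpNorm_le_of_lintegral_le {φ : D → ℝ} (hφ : Continuous φ) {u : D → ℂ} {M : ℝ} (hM : 0 ≤ M)
    (h : ∫⁻ x, ENNReal.ofReal (‖u x‖ ^ 2 * Real.exp (-φ x)) ∂D.vol ≤ ENNReal.ofReal (M ^ 2)) :
    eLpNorm u 2 (D.volW φ) ≤ ENNReal.ofReal M := by
  rw [FluidPDE.eLpNorm_two_eq_rpow, ← lintegral_ofReal_norm_sq_mul_exp hφ]
  calc (∫⁻ x, ENNReal.ofReal (‖u x‖ ^ 2 * Real.exp (-φ x)) ∂D.vol) ^ (1 / 2 : ℝ)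
      ≤ (ENNReal.ofReal (M ^ 2)) ^ (1 / 2 : ℝ) := ENNReal.rpow_le_rpow h (by norm_num)
    _ = ENNReal.ofReal M := by
        rw [ENNReal.ofReal_pow hM, ← ENNReal.rpow_natCast, ← ENNReal.rpow_mul]; norm_num

omit [DecidableEq ι] in
/-- A.e. statements transport from a chart source to its target. [folklore] -/
theorem ae_target_of_ae_source {e : OpenPartialHomeomorph D (ι → ℂ)} (he : ⇑e = D.proj) {p : D → Prop}
    (h : ∀ᵐ y ∂D.vol, y ∈ e.source → p y) : ∀ᵐ z ∂volume, z ∈ e.target → p (e.symm z) := by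
  have hmeas : AEMeasurable e.symm (volume.restrict e.target) := e.continuousOn_symm.aemeasurable e.open_target.measurableSet
  have h1 : ∀ᵐ y ∂(D.vol.restrict e.source), p y := (ae_restrict_iff' e.open_source.measurableSet).2 h
  rw [← map_symm_volume_restrict he] at h1
  have h2 := ae_of_ae_map hmeas h1
  exact (ae_restrict_iff' e.open_target.measurableSet).1 h2

omit [DecidableEq ι] in
/-- **`lintegral` along a chart**: `∫⁻_{e⁻¹(B)} F d vol = ∫⁻_B F ∘ e⁻¹ dλ` for Borel `B ⊆ e.target`.
[folklore] -/
theorem setLIntegral_symm_image {e : OpenPartialHomeomorph D (ι → ℂ)} (he : ⇑e = D.proj) {B : Set (ι → ℂ)}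
    (hB : MeasurableSet B) (hBe : B ⊆ e.target) {F : D → ℝ≥0∞} (hF : AEMeasurable F D.vol) :
    ∫⁻ y in e.symm '' B, F y ∂D.vol = ∫⁻ z in B, F (e.symm z) ∂volume := by
  have hmeas : AEMeasurable e.symm (volume.restrict e.target) := e.continuousOn_symm.aemeasurable e.open_target.measurableSet
  have hmeasB : AEMeasurable e.symm (volume.restrict B) := (e.continuousOn_symm.mono hBe).aemeasurable hB
  have hsub : e.symm '' B ⊆ e.source := fun y ⟨z, hz, hzy⟩ ↦ hzy ▸ e.map_target (hBe hz)
  have himB : MeasurableSet (e.symm '' B) := by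
    rw [e.symm_image_eq_source_inter_preimage hBe, he]
    exact e.open_source.measurableSet.inter (D.measurable_proj hB)
  have hpre : e.symm ⁻¹' (e.symm '' B) ∩ e.target = B := by
    ext z
    constructor
    · rintro ⟨⟨z', hz', hzz'⟩, hz⟩
      have : z' = z := by
        have h1 := congrArg e hzz'
        rwa [e.right_inv (hBe hz'), e.right_inv hz] at h1
      exact this ▸ hz'
    · exact fun hz ↦ ⟨⟨z, hz, rfl⟩, hBe hz⟩
  have h1 : D.vol.restrict (e.symm '' B) = (volume.restrict B).map e.symm := by
    have h2 : D.vol.restrict (e.symm '' B) = (D.vol.restrict e.source).restrict (e.symm '' B) := by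
      rw [Measure.restrict_restrict himB, inter_eq_left.2 hsub]
    rw [h2, ← map_symm_volume_restrict he, Measure.restrict_map_of_aemeasurable hmeas himB,
      Measure.restrict_restrict' e.open_target.measurableSet, hpre]
  rw [h1, lintegral_map' (hF.mono_measure (by rw [← h1]; exact Measure.restrict_le_self)) hmeasB]

variable [Nonempty ι]
variable {φ₀ s : D → ℝ} (hφ₀ : ContMDiff 𝓘(ℝ, ι → ℂ) 𝓘(ℝ, ℝ) ∞ φ₀) (hs : ContMDiff 𝓘(ℝ, ι → ℂ) 𝓘(ℝ, ℝ) ∞ s)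
  (hsK : ∀ b : ℝ, IsCompact {x | s x ≤ b})
  {c₀ m : D → ℝ} (hc₀ : Continuous c₀) (hc₀0 : ∀ x, 0 < c₀ x) (hm : Continuous m) (hm0 : ∀ x, 0 < m x)
  (hLevi₀ : ∀ (x : D) (v : ι → ℂ), c₀ x * ∑ j, ‖v j‖ ^ 2 ≤
    (∑ j, ∑ k, del (Pi.single j 1) (dbar (Pi.single k 1) (fun z ↦ (φ₀ z : ℂ))) x * v j * conj (v k)).re)
  (hsLevi : ∀ (x : D) (v : ι → ℂ), m x * ∑ j, ‖v j‖ ^ 2 ≤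
    (∑ j, ∑ k, del (Pi.single j 1) (dbar (Pi.single k 1) (fun z ↦ (s z : ℂ))) x * v j * conj (v k)).re)

/-- The regularised weights `φ_ε = φ₀ + n f_ε`. [cite: HormanderSCV1973, Thm 4.4.3 (proof)] -/
def regWeight (D : RiemannDomain.{u} ι) (φ₀ : D → ℝ) (z₀ : ι → ℂ) (ε : ℝ) (y : D) : ℝ :=
  φ₀ y + Fintype.card ι * D.pointWeight z₀ ε y

include hφ₀ in
omit [DecidableEq ι] [Nonempty ι] in
/-- The regularised weights are `C^∞` for `ε ≠ 0`. [folklore] -/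
theorem contMDiff_regWeight (z₀ : ι → ℂ) {ε : ℝ} (hε : ε ≠ 0) : ContMDiff 𝓘(ℝ, ι → ℂ) 𝓘(ℝ, ℝ) ∞ (D.regWeight φ₀ z₀ ε) :=
  hφ₀.add (contMDiff_const.mul (contMDiff_pointWeight z₀ hε))

include hφ₀ hLevi₀ in
omit [Nonempty ι] in
/-- **The Levi form of `φ_ε` dominates that of `φ₀`**: `∑ (φ_ε)_{jk̄} v_j v̄_k ≥ c₀ |v|²`.
[cite: HormanderSCV1973, Thm 4.4.3 (proof)] -/
theorem levi_regWeight (z₀ : ι → ℂ) {ε : ℝ} (hε : ε ≠ 0) (x : D) (v : ι → ℂ) :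
    c₀ x * ∑ j, ‖v j‖ ^ 2 ≤
      (∑ j, ∑ k, del (Pi.single j 1) (dbar (Pi.single k 1) (fun z ↦ (D.regWeight φ₀ z₀ ε z : ℂ))) x * v j * conj (v k)).re := by
  have hf : ContMDiff 𝓘(ℝ, ι → ℂ) 𝓘(ℝ, ℂ) ∞ fun y ↦ (D.pointWeight z₀ ε y : ℂ) := contMDiff_ofReal (contMDiff_pointWeight z₀ hε)
  have hnf : ContMDiff 𝓘(ℝ, ι → ℂ) 𝓘(ℝ, ℂ) ∞ fun y ↦ (Fintype.card ι : ℂ) * (D.pointWeight z₀ ε y : ℂ) := contMDiff_mul contMDiff_const hf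
  have hfun : (fun z ↦ (D.regWeight φ₀ z₀ ε z : ℂ)) = fun z ↦ (φ₀ z : ℂ) + (Fintype.card ι : ℂ) * (D.pointWeight z₀ ε z : ℂ) := by
    funext z; simp [regWeight]
  -- `∂_a ∂̄_b (n f) = n ∂_a ∂̄_b f`
  have hscal : ∀ a b, del a (dbar b (fun y ↦ (Fintype.card ι : ℂ) * (D.pointWeight z₀ ε y : ℂ))) x =
      (Fintype.card ι : ℂ) * del a (dbar b (fun y ↦ (D.pointWeight z₀ ε y : ℂ))) x := by
    intro a b
    have h1 : dbar b (fun y ↦ (Fintype.card ι : ℂ) * (D.pointWeight z₀ ε y : ℂ)) =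
        fun y ↦ (Fintype.card ι : ℂ) * dbar b (fun y ↦ (D.pointWeight z₀ ε y : ℂ)) y := by
      funext y
      rw [dbar_mul_apply contMDiff_const hf, dbar_const, zero_mul, add_zero]
    rw [h1, del_mul_apply contMDiff_const (contMDiff_dbar hf b), del_const, zero_mul, add_zero]
  have hsum : (∑ j, ∑ k, del (Pi.single j 1) (dbar (Pi.single k 1) (fun z ↦ (D.regWeight φ₀ z₀ ε z : ℂ))) x * v j * conj (v k)).re =
      (∑ j, ∑ k, del (Pi.single j 1) (dbar (Pi.single k 1) (fun z ↦ (φ₀ z : ℂ))) x * v j * conj (v k)).re +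
        Fintype.card ι * (∑ j, ∑ k, del (Pi.single j 1) (dbar (Pi.single k 1) (fun z ↦ (D.pointWeight z₀ ε z : ℂ))) x * v j * conj (v k)).re := by
    rw [hfun]
    simp_rw [del_dbar_add (contMDiff_ofReal hφ₀) hnf, hscal]
    rw [← re_ofReal_mul, ← ofReal_natCast, ← add_re, Finset.mul_sum, ← Finset.sum_add_distrib]
    congr 1
    refine Finset.sum_congr rfl fun j _ ↦ ?_
    rw [Finset.mul_sum, ← Finset.sum_add_distrib]
    exact Finset.sum_congr rfl fun k _ ↦ by push_cast; ring
  rw [hsum]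
  have h0 := re_levi_pointWeight_nonneg (z₀ := z₀) hε x v
  nlinarith [hLevi₀ x v, h0, Nat.cast_nonneg (α := ℝ) (Fintype.card ι)]

include hφ₀ hs hsK hc₀ hc₀0 hm hm0 hLevi₀ hsLevi in
/-- **`L²` interpolation on a flat Riemann domain** (Hörmander, Theorems 4.4.3–4.4.4, in the `L²`
form used for Riemann existence). Let `D` carry a `C^∞` exhaustion `s` with `∑ s_{jk̄} v_j v̄_k ≥ m|v|²`
(`m > 0` continuous) and a `C^∞` weight `φ₀` with `∑ (φ₀)_{jk̄} v_j v̄_k ≥ c₀|v|²` (`c₀ > 0`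
continuous). For distinct points `t₁, …, t_N` of one fibre `proj tᵢ = z₀` and values `cᵢ` there is a
continuous `h : D → ℂ`, holomorphic along every local inverse of `proj`, with `h(tᵢ) = cᵢ` and
`h ∈ L²(D, e^{-φ₀} (N + 1)^{-n} d vol)`, `N = ∑_k |proj_k - z₀_k|²`, `n = card ι`.
[cite: HormanderSCV1973, Thm 4.4.3–4.4.4 (pp. 93–94)] -/
theorem exists_flatHolomorphic_interpolating {N : ℕ} {t : Fin N → D} (ht : Function.Injective t) {z₀ : ι → ℂ}
    (htz : ∀ i, D.proj (t i) = z₀) (c : Fin N → ℂ) :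
    ∃ h : D → ℂ, Continuous h ∧
      (∀ e : OpenPartialHomeomorph D (ι → ℂ), ⇑e = D.proj → DifferentiableOn ℂ (h ∘ e.symm) e.target) ∧
      (∀ i, h (t i) = c i) ∧ MemLp h 2 (D.volW (D.regWeight φ₀ z₀ 1)) := by
  classical
  set n : ℕ := Fintype.card ι with hn
  have hn1 : 1 ≤ n := Fintype.card_pos
  -- sheets and the cut-off datum
  obtain ⟨e, r, hr, he, hte, het, hdisj⟩ := exists_sheets ht htz
  obtain ⟨u₀, hu₀, hu₀loc, hu₀supp⟩ := exists_cutoff_datum e hr he het hdisj c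
  set g : ι → D → ℂ := fun j ↦ dbar (Pi.single j 1) u₀ with hg
  have hgt : ∀ j, IsTest (g j) := fun j ↦ hu₀.dbar _
  have hclosed : ∀ (j k : ι) (x : D), dbar (Pi.single j 1) (g k) x = dbar (Pi.single k 1) (g j) x := fun j k x ↦
    dbar_dbar_comm hu₀.contMDiff _ _ x
  -- the open set `O` where `u₀` is locally constant and `g = 0`
  set O : Set D := ⋃ i, (e i).source ∩ D.proj ⁻¹' ball z₀ r with hO
  have hOopen : IsOpen O := isOpen_iUnion fun i ↦ (e i).open_source.inter (isOpen_ball.preimage D.isLocalHomeomorph.continuous)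
  have htO : ∀ i, t i ∈ (e i).source ∩ D.proj ⁻¹' ball z₀ r := fun i ↦ ⟨hte i, by rw [mem_preimage, htz i]; exact mem_ball_self hr⟩
  have hgO : ∀ y ∈ O, ∀ j, g j y = 0 := by
    intro y hy j
    obtain ⟨i, hyi⟩ := mem_iUnion.1 hy
    exact dbar_eq_zero_of_eventuallyEq_const (hu₀loc i y hyi.1 hyi.2) _
  -- the uniform bound `M`
  set Ig : ℝ := ∫ x, (∑ j, ‖g j x‖ ^ 2) * (Real.exp (-φ₀ x) * ((r ^ 2) ^ n)⁻¹) / c₀ x ∂D.vol with hIg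
  have hIg0 : 0 ≤ Ig := integral_nonneg fun x ↦ by have := hc₀0 x; positivity
  set M : ℝ := Real.sqrt (2 * Ig) with hM
  have hM0 : 0 ≤ M := Real.sqrt_nonneg _
  have hM2 : M ^ 2 = 2 * Ig := Real.sq_sqrt (by positivity)
  -- the regularised problems
  set εk : ℕ → ℝ := fun k ↦ 1 / ((k : ℝ) + 1) with hεk
  have hεk0 : ∀ k, 0 < εk k := fun k ↦ by positivity
  have hεk1 : ∀ k, εk k ≤ 1 := fun k ↦ by
    simp only [hεk]
    rw [div_le_one (by positivity)]
    linarith [(Nat.cast_nonneg k : (0 : ℝ) ≤ k)]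
  have hεkmono : ∀ k k', k ≤ k' → εk k' ≤ εk k := fun k k' hkk' ↦ by
    simp only [hεk]
    have hkk : (k : ℝ) ≤ k' := by exact_mod_cast hkk'
    exact one_div_le_one_div_of_le (by positivity) (by linarith)
  set φk : ℕ → D → ℝ := fun k ↦ D.regWeight φ₀ z₀ (εk k) with hφk
  have hφks : ∀ k, ContMDiff 𝓘(ℝ, ι → ℂ) 𝓘(ℝ, ℝ) ∞ (φk k) := fun k ↦ contMDiff_regWeight hφ₀ z₀ (hεk0 k).ne'
  -- pointwise description of the weights
  have hexp_reg : ∀ {ε : ℝ}, ε ≠ 0 → ∀ y, Real.exp (-D.regWeight φ₀ z₀ ε y) =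
      Real.exp (-φ₀ y) * ((D.distSq z₀ y + ε ^ 2) ^ n)⁻¹ := by
    intro ε hε y
    have hq := distSq_add_sq_pos z₀ hε y
    rw [regWeight, ← hn, neg_add, Real.exp_add]
    congr 1
    rw [pointWeight, show -((n : ℝ) * Real.log (D.distSq z₀ y + ε ^ 2)) = -((n : ℕ) * Real.log (D.distSq z₀ y + ε ^ 2)) by rfl,
      Real.exp_neg, Real.exp_nat_mul, Real.exp_log hq]
  have hexpφ : ∀ k y, Real.exp (-φk k y) = Real.exp (-φ₀ y) * ((D.distSq z₀ y + εk k ^ 2) ^ n)⁻¹ := fun k y ↦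
    hexp_reg (hεk0 k).ne' y
  set Φ : D → ℝ := D.regWeight φ₀ z₀ 1 with hΦ
  have hΦs : ContMDiff 𝓘(ℝ, ι → ℂ) 𝓘(ℝ, ℝ) ∞ Φ := contMDiff_regWeight hφ₀ z₀ one_ne_zero
  have hΦc : Continuous Φ := hΦs.continuous
  have hexpΦ : ∀ y, Real.exp (-Φ y) = Real.exp (-φ₀ y) * ((D.distSq z₀ y + 1) ^ n)⁻¹ := fun y ↦ by
    rw [hΦ, hexp_reg one_ne_zero y, one_pow]
  -- monotonicity of the weights in `ε`
  have hinv_mono : ∀ {a b : ℝ} (y : D), 0 < a → a ≤ b → ((D.distSq z₀ y + b) ^ n)⁻¹ ≤ ((D.distSq z₀ y + a) ^ n)⁻¹ :=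
    fun y ha hab ↦ by
    have hN := distSq_nonneg z₀ y
    exact inv_anti₀ (pow_pos (by linarith) _) (pow_le_pow_left₀ (by linarith) (by linarith) _)
  have hφk_le_Φ : ∀ k y, Real.exp (-Φ y) ≤ Real.exp (-φk k y) := fun k y ↦ by
    rw [hexpΦ, hexpφ]
    refine mul_le_mul_of_nonneg_left (hinv_mono y (pow_pos (hεk0 k) 2) ?_) (Real.exp_pos _).le
    have := hεk1 k
    have := hεk0 k
    nlinarith
  have hφk_mono : ∀ k k' y, k ≤ k' → Real.exp (-φk k y) ≤ Real.exp (-φk k' y) := fun k k' y hkk' ↦ by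
    rw [hexpφ, hexpφ]
    refine mul_le_mul_of_nonneg_left (hinv_mono y (pow_pos (hεk0 k') 2) ?_) (Real.exp_pos _).le
    exact pow_le_pow_left₀ (hεk0 k').le (hεkmono k k' hkk') 2
  -- the regularised solutions
  have hsol : ∀ k, ∃ w : D → ℂ, MemLp w 2 (D.volW (φk k)) ∧ HasWeakDbar D w (fun x j ↦ g j x) ∧
      ∫ x, ‖w x‖ ^ 2 * Real.exp (-φk k x) ∂D.vol ≤ 2 * ∫ x, (∑ j, ‖g j x‖ ^ 2) * Real.exp (-φk k x) / c₀ x ∂D.vol :=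
    fun k ↦ hormander_existence (hφks k) hs hsK hc₀ hc₀0 hm hm0 (levi_regWeight hφ₀ hLevi₀ z₀ (hεk0 k).ne') hsLevi hgt hclosed
  choose v hvmem hvweak hvint using hsol
  -- the uniform bound: `∫ |g|² e^{-φ_k}/c₀ ≤ Ig`
  have hGsum : Continuous fun x ↦ ∑ j, ‖g j x‖ ^ 2 := continuous_finsetSum _ fun j _ ↦ ((hgt j).continuous.norm).pow 2
  have hGsum0 : ∀ x ∉ ⋃ j, tsupport (g j), ∑ j, ‖g j x‖ ^ 2 = 0 := fun x hx ↦
    Finset.sum_eq_zero fun j _ ↦ by rw [(eq_zero_of_notMem_iUnion_tsupport hx j 0).1, norm_zero]; ring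
  have hGc : IsCompact (⋃ j, tsupport (g j)) := isCompact_iUnion_tsupport hgt
  have hIgint : Integrable (fun x ↦ (∑ j, ‖g j x‖ ^ 2) * (Real.exp (-φ₀ x) * ((r ^ 2) ^ n)⁻¹) / c₀ x) D.vol := by
    refine Continuous.integrable_of_hasCompactSupport ((hGsum.mul ((Real.continuous_exp.comp hφ₀.continuous.neg).mul
      continuous_const)).div hc₀ fun x ↦ (hc₀0 x).ne') ?_
    exact HasCompactSupport.intro' hGc (isClosed_iUnion_of_finite fun j ↦ isClosed_tsupport _)
      fun x hx ↦ by simp only [hGsum0 x hx, zero_mul, zero_div]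
  have hbound : ∀ k, ∫ x, (∑ j, ‖g j x‖ ^ 2) * Real.exp (-φk k x) / c₀ x ∂D.vol ≤ Ig := by
    intro k
    refine integral_mono_of_nonneg (ae_of_all _ fun x ↦ by have := hc₀0 x; positivity) hIgint (ae_of_all _ fun x ↦ ?_)
    refine div_le_div_of_nonneg_right ?_ (hc₀0 x).le
    by_cases hx : ∑ j, ‖g j x‖ ^ 2 = 0
    · rw [hx, zero_mul, zero_mul]
    · -- some `g_j x ≠ 0`, so `N(x) ≥ r²`
      have hj : ∃ j, g j x ≠ 0 := by
        by_contra hall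
        push Not at hall
        exact hx (Finset.sum_eq_zero fun j _ ↦ by rw [hall j, norm_zero]; ring)
      obtain ⟨j, hj⟩ := hj
      have hN : r ^ 2 ≤ D.distSq z₀ x := hu₀supp x (Pi.single j 1) hj
      rw [hexpφ]
      refine mul_le_mul_of_nonneg_left (mul_le_mul_of_nonneg_left ?_ (Real.exp_pos _).le) (Finset.sum_nonneg fun _ _ ↦ sq_nonneg _)
      exact inv_anti₀ (pow_pos (by positivity) _) (pow_le_pow_left₀ (by positivity) (by nlinarith [sq_nonneg (εk k)]) _)
  have hvM : ∀ k, ∫ x, ‖v k x‖ ^ 2 * Real.exp (-φk k x) ∂D.vol ≤ M ^ 2 := fun k ↦ by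
    rw [hM2]; exact (hvint k).trans (by linarith [hbound k])
  -- in `lintegral` form
  have hvmeas : ∀ k, AEStronglyMeasurable (v k) D.vol := fun k ↦ aestronglyMeasurable_of_memLp_volW (hφks k).continuous (hvmem k)
  have hvlin : ∀ k, ∫⁻ x, ENNReal.ofReal (‖v k x‖ ^ 2 * Real.exp (-φk k x)) ∂D.vol ≤ ENNReal.ofReal (M ^ 2) := by
    intro k
    have hint : Integrable (fun x ↦ ‖v k x‖ ^ 2 * Real.exp (-φk k x)) D.vol :=
      (memLp_two_volW_iff (hφks k).continuous (hvmeas k)).1 (hvmem k)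
    rw [← ofReal_integral_eq_lintegral_ofReal hint (ae_of_all _ fun x ↦ by positivity)]
    exact ENNReal.ofReal_le_ofReal (hvM k)
  -- all `v_k` in one space `L²(e^{-Φ})`
  have hvolle : ∀ k, D.volW Φ ≤ D.volW (φk k) := fun k ↦ by
    refine withDensity_mono (ae_of_all _ fun x ↦ ?_)
    rw [ENNReal.coe_le_coe, ← NNReal.coe_le_coe, coe_weight, coe_weight]
    exact hφk_le_Φ k x
  have hvmemΦ : ∀ k, MemLp (v k) 2 (D.volW Φ) := fun k ↦ (hvmem k).mono_measure (hvolle k)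
  have hvnormΦ : ∀ k, eLpNorm (v k) 2 (D.volW Φ) ≤ ENNReal.ofReal M := fun k ↦
    (eLpNorm_mono_measure _ (hvolle k)).trans (eLpNorm_le_of_lintegral_le (hφks k).continuous hM0 (hvlin k))
  -- the weights `w_{k₀} = e^{-φ_{k₀}}` and the weak limit
  set w : ℕ → D → ℝ := fun k₀ y ↦ Real.exp (-φk k₀ y) with hw
  have hwm : ∀ k₀, Measurable (w k₀) := fun k₀ ↦ (Real.continuous_exp.comp (hφks k₀).continuous.neg).measurable
  have hw0 : ∀ k₀ x, 0 ≤ w k₀ x := fun k₀ x ↦ (Real.exp_pos _).le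
  have hwC : ∀ k₀, ∃ C, 0 ≤ C ∧ ∀ x, w k₀ x ≤ C * Real.exp (-Φ x) := by
    intro k₀
    refine ⟨((εk k₀ ^ 2)⁻¹) ^ n, by positivity, fun x ↦ ?_⟩
    simp only [hw]
    rw [hexpφ, hexpΦ, mul_left_comm]
    refine mul_le_mul_of_nonneg_left ?_ (Real.exp_pos _).le
    have hN := distSq_nonneg z₀ x
    have hε := hεk0 k₀
    have hε1 := hεk1 k₀
    have key : (εk k₀ ^ 2 * (D.distSq z₀ x + 1)) ^ n ≤ (D.distSq z₀ x + εk k₀ ^ 2) ^ n :=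
      pow_le_pow_left₀ (by positivity) (by nlinarith [mul_nonneg hN (sq_nonneg (εk k₀)), pow_le_one₀ (n := 2) hε.le hε1]) _
    calc ((D.distSq z₀ x + εk k₀ ^ 2) ^ n)⁻¹ ≤ ((εk k₀ ^ 2 * (D.distSq z₀ x + 1)) ^ n)⁻¹ := inv_anti₀ (by positivity) key
      _ = (εk k₀ ^ 2)⁻¹ ^ n * ((D.distSq z₀ x + 1) ^ n)⁻¹ := by rw [mul_pow, mul_inv, inv_pow]
  have hvw : ∀ k₀, ∀ᶠ k in atTop, ∫⁻ x, ENNReal.ofReal (‖v k x‖ ^ 2 * w k₀ x) ∂D.vol ≤ ENNReal.ofReal (M ^ 2) := by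
    intro k₀
    filter_upwards [eventually_ge_atTop k₀] with k hk
    refine le_trans (lintegral_mono fun x ↦ ENNReal.ofReal_le_ofReal ?_) (hvlin k)
    exact mul_le_mul_of_nonneg_left (hφk_mono k₀ k x hk) (sq_nonneg _)
  obtain ⟨V, hVmem, -, hVweak, hVbd⟩ := exists_weak_limit hΦc (fun j ↦ locallyIntegrable_of_continuous (hgt j).continuous)
    hvmemΦ hM0 hvnormΦ hvweak hwm hw0 hwC hvw
  have hVmeas : AEStronglyMeasurable V D.vol := aestronglyMeasurable_of_memLp_volW hΦc hVmem
  -- the singular limit weight: `∫ |V|² e^{-φ₀} N^{-n} ≤ M²`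
  have hsing_eq : ∀ y, singWeight (D.proj y - z₀) = ENNReal.ofReal ((D.distSq z₀ y ^ n)⁻¹) := fun y ↦ rfl
  have hVsing : ∫⁻ y, ENNReal.ofReal (‖V y‖ ^ 2 * Real.exp (-φ₀ y)) * singWeight (D.proj y - z₀) ∂D.vol ≤ ENNReal.ofReal (M ^ 2) := by
    set G : ℕ → D → ℝ≥0∞ := fun k₀ y ↦ ENNReal.ofReal (‖V y‖ ^ 2 * w k₀ y) with hG
    have hGmono : ∀ y, Monotone fun k₀ ↦ G k₀ y := fun y k₀ k₁ hk ↦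
      ENNReal.ofReal_le_ofReal (mul_le_mul_of_nonneg_left (hφk_mono k₀ k₁ y hk) (sq_nonneg _))
    have hGmeas : ∀ k₀, AEMeasurable (G k₀) D.vol := fun k₀ ↦
      ENNReal.measurable_ofReal.comp_aemeasurable ((hVmeas.norm.aemeasurable.pow_const 2).mul (hwm k₀).aemeasurable)
    have hsup : ∫⁻ y, ⨆ k₀, G k₀ y ∂D.vol ≤ ENNReal.ofReal (M ^ 2) := by
      rw [lintegral_iSup' hGmeas (ae_of_all _ hGmono)]
      exact iSup_le hVbd
    refine le_trans (lintegral_mono fun y ↦ ?_) hsup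
    -- pointwise: the singular weight is the limit of the regularised ones
    rcases eq_or_lt_of_le (distSq_nonneg z₀ y) with hN0 | hNpos
    · rw [hsing_eq, ← hN0, zero_pow (by omega), inv_zero, ENNReal.ofReal_zero, mul_zero]
      exact bot_le
    · have hlimG : Tendsto (fun k₀ ↦ G k₀ y) atTop
          (𝓝 (ENNReal.ofReal (‖V y‖ ^ 2 * Real.exp (-φ₀ y)) * singWeight (D.proj y - z₀))) := by
        rw [hsing_eq, ← ENNReal.ofReal_mul (by positivity)]
        have hGy : ∀ k₀, G k₀ y = ENNReal.ofReal (‖V y‖ ^ 2 * Real.exp (-φ₀ y) * ((D.distSq z₀ y + εk k₀ ^ 2) ^ n)⁻¹) := fun k₀ ↦ by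
          simp only [hG, hw, hexpφ, ← mul_assoc]
        simp_rw [hGy]
        refine (ENNReal.continuous_ofReal.tendsto _).comp ?_
        refine Tendsto.const_mul _ ((continuousAt_inv₀ (pow_pos hNpos n).ne').tendsto.comp ?_)
        have hε0 : Tendsto εk atTop (𝓝 0) := by
          simp only [hεk]; exact tendsto_one_div_add_atTop_nhds_zero_nat
        have : Tendsto (fun k₀ ↦ (D.distSq z₀ y + εk k₀ ^ 2) ^ n) atTop (𝓝 ((D.distSq z₀ y + 0 ^ 2) ^ n)) :=
          (tendsto_const_nhds.add (hε0.pow 2)).pow n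
        simpa using this
      exact le_of_eq (tendsto_nhds_unique hlimG (tendsto_atTop_iSup (hGmono y)))
  -- `V` is holomorphic on `O` and vanishes at the `t_i`
  obtain ⟨wf, hwc, hwhol, hwae⟩ := exists_flatHolomorphicOn_ae_eq hVweak hOopen (fun y hy j ↦ hgO y hy j)
  have hwt : ∀ i, wf (t i) = 0 := by
    intro i
    have hBt : ball z₀ r ⊆ (e i).target := ball_subset_closedBall.trans ((closedBall_subset_closedBall (by linarith)).trans (het i))
    have hz₀t : z₀ ∈ (e i).target := hBt (mem_ball_self hr)
    have hsymm : (e i).symm z₀ = t i := by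
      rw [← htz i, ← he i]; exact (e i).left_inv (hte i)
    have himO : ∀ z ∈ ball z₀ r, (e i).symm z ∈ O := fun z hz ↦
      mem_iUnion.2 ⟨i, (e i).map_target (hBt hz), by rw [mem_preimage, D.proj_symm_apply (he i) (hBt hz)]; exact hz⟩
    -- the function `H = (wf ∘ e⁻¹) e^{-φ₀ ∘ e⁻¹ / 2}` on the polydisc
    set H : (ι → ℂ) → ℂ := fun z ↦ wf ((e i).symm z) * (Real.exp (-φ₀ ((e i).symm z) / 2) : ℂ) with hH
    have hHnorm : ∀ z, ‖H z‖ ^ 2 = ‖wf ((e i).symm z)‖ ^ 2 * Real.exp (-φ₀ ((e i).symm z)) := fun z ↦ by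
      have hE : Real.exp (-φ₀ ((e i).symm z) / 2) ^ 2 = Real.exp (-φ₀ ((e i).symm z)) := by
        rw [← Real.exp_nat_mul]; congr 1; push_cast; ring
      simp only [hH, norm_mul, norm_real, Real.norm_eq_abs, abs_of_pos (Real.exp_pos _), mul_pow, hE]
    have hHcont : ContinuousAt H z₀ := by
      have hsc : ContinuousAt (e i).symm z₀ := (e i).continuousAt_symm hz₀t
      have hwfc : ContinuousAt wf ((e i).symm z₀) := by
        rw [hsymm]; exact hwc.continuousAt (hOopen.mem_nhds (mem_iUnion.2 ⟨i, htO i⟩))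
      have hφc : ContinuousAt (fun z ↦ (Real.exp (-φ₀ ((e i).symm z) / 2) : ℂ)) z₀ :=
        continuous_ofReal.continuousAt.comp (Real.continuous_exp.continuousAt.comp
          (((hφ₀.continuous.continuousAt).comp hsc).neg.div_const _))
      exact (hwfc.comp hsc).mul hφc
    have hfin : ∫⁻ z in ball z₀ r, ENNReal.ofReal (‖H z‖ ^ 2) * singWeight (z - z₀) < ⊤ := by
      -- rewrite with `V` in place of `wf`, then change variables to `D`
      have haeV : ∀ᵐ z ∂volume, z ∈ (e i).target → ((e i).symm z ∈ O → V ((e i).symm z) = wf ((e i).symm z)) :=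
        ae_target_of_ae_source (he i) (hwae.mono fun y hy _ ↦ hy)
      have h1 : ∫⁻ z in ball z₀ r, ENNReal.ofReal (‖H z‖ ^ 2) * singWeight (z - z₀) =
          ∫⁻ z in ball z₀ r, ENNReal.ofReal (‖V ((e i).symm z)‖ ^ 2 * Real.exp (-φ₀ ((e i).symm z))) *
            singWeight (D.proj ((e i).symm z) - z₀) := by
        refine setLIntegral_congr_fun_ae measurableSet_ball ?_
        filter_upwards [haeV] with z hz hzb
        rw [hHnorm, hz (hBt hzb) (himO z hzb), D.proj_symm_apply (he i) (hBt hzb)]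
      have hFm : AEMeasurable (fun y ↦ ENNReal.ofReal (‖V y‖ ^ 2 * Real.exp (-φ₀ y)) * singWeight (D.proj y - z₀)) D.vol :=
        (ENNReal.measurable_ofReal.comp_aemeasurable ((hVmeas.norm.aemeasurable.pow_const 2).mul
          (Real.measurable_exp.comp hφ₀.continuous.measurable.neg).aemeasurable)).mul
          (measurable_singWeight.comp (D.measurable_proj.sub_const z₀)).aemeasurable
      have h2 := setLIntegral_symm_image (he i) measurableSet_ball hBt hFm
      rw [h1, ← h2]
      exact lt_of_le_of_lt ((lintegral_mono_set (subset_univ _)).trans (le_of_eq (setLIntegral_univ _))) (hVsing.trans_lt ENNReal.ofReal_lt_top)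
    have hH0 := eq_zero_of_lintegral_lt_top hHcont hr hfin
    simp only [hH, hsymm, mul_eq_zero, ofReal_eq_zero, Real.exp_ne_zero, or_false] at hH0
    exact hH0
  -- the global holomorphic function `h = u₀ - V`
  have hu₀weak : HasWeakDbar D u₀ (fun x j ↦ g j x) := hasWeakDbar_of_contMDiff hu₀.contMDiff
  have hdiff : HasWeakDbar D (fun x ↦ u₀ x - V x) (fun _ _ ↦ 0) :=
    (hu₀weak.sub hVweak).congr_ae EventuallyEq.rfl fun j ↦ Eventually.of_forall fun x ↦ by simp [hg]
  obtain ⟨h, hhc, hhol, hhae⟩ := exists_flatHolomorphic_ae_eq hdiff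
  refine ⟨h, hhc, hhol, fun i ↦ ?_, ?_⟩
  · -- `h = c_i - wf` on `O_i`, hence `h(t_i) = c_i`
    set Oi : Set D := (e i).source ∩ D.proj ⁻¹' ball z₀ r with hOi
    have hOio : IsOpen Oi := (e i).open_source.inter (isOpen_ball.preimage D.isLocalHomeomorph.continuous)
    have hOiO : Oi ⊆ O := subset_iUnion (fun i ↦ (e i).source ∩ D.proj ⁻¹' ball z₀ r) i
    have haei : h =ᵐ[D.vol.restrict Oi] fun y ↦ c i - wf y := by
      rw [EventuallyEq, ae_restrict_iff' hOio.measurableSet]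
      filter_upwards [hhae, hwae] with y hy hyw hyO
      rw [← hy, hyw (hOiO hyO), (hu₀loc i y hyO.1 hyO.2).self_of_nhds]
    have heq := Measure.eqOn_open_of_ae_eq haei hOio hhc.continuousOn ((continuousOn_const.sub (hwc.mono hOiO))) (htO i)
    rw [heq]
    simp only [hwt i, sub_zero]
  · -- `h ∈ L²(e^{-Φ})`
    haveI : IsFiniteMeasureOnCompacts (D.volW Φ) := isFiniteMeasureOnCompacts_volW hΦc
    have hmem : MemLp (fun x ↦ u₀ x - V x) 2 (D.volW Φ) := (hu₀.memLp 2 (D.volW Φ)).sub hVmem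
    exact hmem.ae_eq ((eventuallyEq_volW_iff hΦc).2 hhae)

end Interpolation

end RiemannDomain

end Literature.Analysis.Complex
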